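import Literature.NumberTheory.Transcendental.PhilipponZeroEstimateStd
import Literature.NumberTheory.Transcendental.PkappaThetaAddition
import Literature.NumberTheory.Transcendental.TorsionOrbit
import Literature.NumberTheory.Transcendental.BakerQuantVandermonde
import Literature.NumberTheory.Transcendental.ChudnovskyPeriods
import Literature.NumberTheory.EllipticCurves.WeierstrassZetaLegendre
import Mathlib.LinearAlgebra.FreeModule.PID
import Mathlib.Algebra.Module.Projective
import HarnessLib

/-!
# Zariski closures in the theta model of `M_κ`: translation orbits and the algebraic hull of a subspace

Topic `Literature/NumberTheory/Transcendental`. Support for the classification of the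
`Θ`-closed irreducible subgroups of `Lie M_κ,ℂ` (the obstruction subgroups of Philippon's zero
estimate, `philippon1986_std` / D. Roy, LNM 1752 Ch. 11 Thm. 4.1, in the theta model of
`PkappaTheta.lean`) in the case of AT MOST ONE elliptic factor, complex multiplication allowed —
the case needed for the one-period corollaries of Huber–Wüstholz (2022), Thm. 15.3 (1)
(`EllipticPeriodLogSpanProofs.lean`, `SemistabilityOneFactor.lean`).

Write `V = Lie M_κ,ℂ = ℂ^β × ℂ^γ × ℂ^δ` (coordinates `y'_j, z'_b, s_e`, `GaGmE.Std.iy/iz/is`) and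
`F_P(w) = P(Θ(w))` (`GaGmE.Std.thetaEval`). The theta functions are exponentials in `y'`,
AFFINE in `s` with `y', s`-free slopes (`Θ_{(a,(M,some e))} = s_e Θ_{(a,(M,none))} - (ζ-companions)`),
and depend on `z'` through the blocks `P_i, Z_i`; so along a translation vector `r` with `z'(r) = 0`

  `F_P(w + n r) = ∑_μ α_μ^n Q_μ(n)`, `α_μ = e^{⟨m_μ, y'(r)⟩}`, `Q_μ ∈ ℂ[X]`

is an exponential polynomial in `n` (`thetaEval_add_natMul`). Baker's generalised Vandermonde
lemma (`BakerQuantVandermonde.lean`) then gives the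

* **Periodicity (orbit-closure) lemma** (`thetaEval_eq_zero_of_forall_natMul`): if `F_P` vanishes
  at `w + n r` for all `n ∈ ℕ`, it vanishes at `w + (θ, 0, τ s(r))` for every `τ ∈ ℂ` and every
  `θ ∈ ℂ^β` orthogonal to the integer relations `q` with `e^{⟨q, y'(r)⟩} = 1` — the Zariski closure of
  the orbit `w + ℕr` contains the translate of the connected algebraic hull of `r`;
* its version for a translation `t` with LATTICE `E`-coordinates (`…_of_forall_natMul_lattice`),
  reduced to the previous one by the automorphy of `Θ` under `ker(exp_{M_κ})`
  (`GaGmE.Std.exists_theta_add_ker`): the `s`-direction freed is `s(t) - κ η(z'(t))`.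

For `|γ| ≤ 1` these moves, the Legendre relation `η₁ω₂ - η₂ω₁ = ±2πi ≠ 0` and `ω₂/ω₁ ∉ ℝ` compute
the **algebraic hull** of a complex subspace `𝔥 ≤ V`: the datum `hullData 𝔥 : SubgroupDataC`
(`A` = rational relations of `y'(𝔥)`, `C = ⊤` or `⊥` according as `z' ≡ 0` on `𝔥` or not,
`Ξ` = the linear forms killing `s(𝔥)` and, when `z' ≢ 0`, the column `κ_{·b}`), with
`𝔥 ≤ (hullData 𝔥).tangent` and

* **hull theorem** (`thetaEval_eq_zero_on_hull`): a FORM `P` with `F_P = 0` on `𝔥` has `F_P = 0`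
  on `(hullData 𝔥).tangent` — i.e. `𝔍(𝔥) = 𝔍(Lie G')` for the connected algebraic subgroup
  `G' ⊇ exp(𝔥)` so described; no hypothesis on complex multiplication is needed because an abelian
  part of dimension `≤ 1` has no proper non-zero abelian subvarieties.

Everything is PROVED; there are no named facts. (The two-or-more-factor analogue needs
`End(E) = ℤ` and is part of the discharge of `philippon1986_std`.)

## References

* D. Bertrand, P. Philippon, *Sous-groupes algébriques de groupes algébriques commutatifs*,
  Illinois J. Math. 32 (1988), 263–280 (algebraic subgroups of products of extensions). [folklore]
* Yu. V. Nesterenko, P. Philippon (eds.), *Introduction to Algebraic Independence Theory*,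
  LNM 1752, Springer 2001, Ch. 11 (D. Roy), Thm. 4.1 (the obstruction subgroup `H₀`).
  [NesterenkoPhilippon2001]
* A. Baker, *Transcendental Number Theory*, CUP 1975, Ch. 3 §2, Lemma 3 (generalised Vandermonde).
  [BakerTNT1975]
* A. Huber, G. Wüstholz, *Transcendence and Linear Relations of 1-Periods*, CUP 2022, Thm. 15.3.
  [HuberWustholz2022]
-/

noncomputable section

open Complex
open scoped PeriodPair

namespace Literature.NumberTheory.Transcendental

namespace GaGmE

namespace Std

variable {β γ δ : Type} [Fintype β] [Fintype γ] [Fintype δ] [DecidableEq γ]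
variable (L : PeriodPair) (κM : δ → γ → Kbar)

/-! ### Translations with vanishing `E`-coordinates -/

/-- The index `(a, (M, none))` under `J = (a, (M, o))`: forget the fibre coordinate. [folklore] -/
def dropFibre (J : Option β × ThetaIdx γ δ) : Option β × ThetaIdx γ δ := (J.1, (J.2.1, none))

/-- The slope of `Θ_J` along a translation `v` with `z'(v) = 0`, at `w`:
`0` for `J = (a, (M, none))`, `s_e(v) · Θ_{(a,(M,none))}(w)` for `J = (a, (M, some e))`. [folklore] -/
def slope (v w : β ⊕ (γ ⊕ δ) → ℂ) (J : Option β × ThetaIdx γ δ) : ℂ :=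
  match J.2.2 with
  | none => 0
  | some e => v (is e) * theta L κM (dropFibre J) w

/-- The logarithm of the torus factor: `0` for `a = none`, `y'_j(v)` for `a = some j`. [folklore] -/
def logT (v : β ⊕ (γ ⊕ δ) → ℂ) : Option β → ℂ
  | none => 0
  | some j => v (iy j)

omit [Fintype β] [Fintype γ] [Fintype δ] [DecidableEq γ] in
/-- `thetaT a v = exp (logT v a)`. [folklore] -/
theorem thetaT_eq_exp_logT (a : Option β) (v : β ⊕ (γ ⊕ δ) → ℂ) :
    thetaT (γ := γ) (δ := δ) a v = cexp (logT v a) := by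
  cases a <;> simp [thetaT, logT]

omit [Fintype β] [Fintype γ] [Fintype δ] [DecidableEq γ] in
/-- The torus factor never vanishes. [folklore] -/
theorem thetaT_ne_zero (a : Option β) (v : β ⊕ (γ ⊕ δ) → ℂ) : thetaT (γ := γ) (δ := δ) a v ≠ 0 := by
  rw [thetaT_eq_exp_logT]; exact exp_ne_zero _

omit [Fintype β] [Fintype γ] [Fintype δ] [DecidableEq γ] in
/-- `thetaT a (n • r) = (thetaT a r)^n`. [folklore] -/
theorem thetaT_natMul (a : Option β) (r : β ⊕ (γ ⊕ δ) → ℂ) (n : ℕ) :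
    thetaT (γ := γ) (δ := δ) a ((n : ℂ) • r) = thetaT a r ^ n := by
  cases a <;> simp [thetaT, ← exp_nat_mul]

omit [Fintype β] [Fintype δ] [DecidableEq γ] in
/-- `Θ^P_{(M,none)}` only sees `z'`. [folklore] -/
theorem thetaPnone_add_of_z (M : γ → Fin 3) {w v : β ⊕ (γ ⊕ δ) → ℂ} (hv : ∀ b, v (iz b) = 0) :
    thetaPnone (β := β) (δ := δ) L M (w + v) = thetaPnone L M w := by
  unfold thetaPnone
  simp [hv]

omit [Fintype β] [Fintype δ] in
/-- `Θ^P_{(M,some e)}` is affine in `s_e` with slope `Θ^P_{(M,none)}`. [folklore] -/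
theorem thetaPsome_add_of_z (M : γ → Fin 3) (e : δ) {w v : β ⊕ (γ ⊕ δ) → ℂ} (hv : ∀ b, v (iz b) = 0) :
    thetaPsome (β := β) L κM M e (w + v) = thetaPsome L κM M e w + v (is e) * thetaPnone L M w := by
  unfold thetaPsome
  rw [thetaPnone_add_of_z L M hv]
  simp only [Pi.add_apply, hv, add_zero]
  ring

omit [Fintype β] [Fintype δ] in
/-- **Translation with `z' = 0`**: `Θ_J(w + v) = T_{J}(v) · (Θ_J(w) + slope_J(v, w))`. [folklore] -/
theorem theta_add_of_z (J : Option β × ThetaIdx γ δ) {w v : β ⊕ (γ ⊕ δ) → ℂ} (hv : ∀ b, v (iz b) = 0) :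
    theta L κM J (w + v) = thetaT J.1 v * (theta L κM J w + slope L κM v w J) := by
  obtain ⟨a, M, _ | e⟩ := J
  · simp only [theta, thetaP_none, slope, add_zero]
    rw [thetaT_add, thetaPnone_add_of_z L M hv, mul_assoc]
  · simp only [theta, thetaP_some, slope, dropFibre, thetaP_none]
    rw [thetaT_add, thetaPsome_add_of_z L κM M e hv]
    ring

omit [Fintype β] [Fintype δ] in
/-- Slopes are linear in the translation: `slope (c • v) = c · slope v`. [folklore] -/
theorem slope_smul (c : ℂ) (v w : β ⊕ (γ ⊕ δ) → ℂ) (J : Option β × ThetaIdx γ δ) :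
    slope L κM (c • v) w J = c * slope L κM v w J := by
  obtain ⟨a, M, _ | e⟩ := J
  · simp [slope]
  · simp [slope, mul_assoc]

omit [Fintype β] [Fintype δ] in
/-- Slopes only see the `s`-coordinates of the translation. [folklore] -/
theorem slope_congr (v v' : β ⊕ (γ ⊕ δ) → ℂ) (h : ∀ e, v (is e) = v' (is e)) (w : β ⊕ (γ ⊕ δ) → ℂ)
    (J : Option β × ThetaIdx γ δ) : slope L κM v w J = slope L κM v' w J := by
  obtain ⟨a, M, _ | e⟩ := J
  · simp [slope]
  · simp [slope, h e]

/-! ### `F_P` along a `z'`-free translation: the exponential-polynomial structure -/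

/-- The `y'`-weight of a theta monomial `X^μ` at `j ∈ β`: `m_μ(j) = ∑_{J = (some j, ·)} μ(J)`.
[folklore] -/
def yWeight (μ : (Option β × ThetaIdx γ δ) →₀ ℕ) (j : β) : ℕ :=
  ∑ J ∈ μ.support, μ J * (Finsupp.single (some j) 1 : Option β →₀ ℕ) J.1

omit [Fintype γ] [Fintype δ] [DecidableEq γ] in
/-- `∏_J T_{J}(v)^{μ J} = exp(∑_j m_μ(j) y'_j(v))`. [folklore] -/
theorem prod_thetaT_pow (μ : (Option β × ThetaIdx γ δ) →₀ ℕ) (v : β ⊕ (γ ⊕ δ) → ℂ) :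
    ∏ J ∈ μ.support, thetaT (γ := γ) (δ := δ) J.1 v ^ μ J = cexp (∑ j, (yWeight μ j : ℂ) * v (iy j)) := by
  classical
  have h1 : ∏ J ∈ μ.support, thetaT (γ := γ) (δ := δ) J.1 v ^ μ J =
      cexp (∑ J ∈ μ.support, (μ J : ℂ) * logT v J.1) := by
    rw [exp_sum]
    refine Finset.prod_congr rfl fun J _ => ?_
    rw [thetaT_eq_exp_logT, ← exp_nat_mul]
  rw [h1]
  congr 1
  -- `logT v a = ∑_j 1_{a = some j} y'_j(v)`
  have hlog : ∀ a : Option β, logT v a = ∑ j, ((Finsupp.single (some j) 1 : Option β →₀ ℕ) a : ℂ) * v (iy j) := by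
    rintro (_ | j')
    · simp [logT]
    · simp only [logT]
      rw [Finset.sum_eq_single j']
      · simp
      · intro j _ hj
        simp [hj]
      · intro h; exact absurd (Finset.mem_univ j') h
  simp only [hlog, Finset.mul_sum, yWeight, Nat.cast_sum, Nat.cast_mul, Finset.sum_mul]
  rw [Finset.sum_comm]
  refine Finset.sum_congr rfl fun j _ => Finset.sum_congr rfl fun J _ => ?_
  ring

/-- The polynomial `Q_μ(X) = c_μ ∏_J (Θ_J(w) + X · slope_J(r, w))^{μ J}` attached to a monomial of
`P`, a base point `w` and a `z'`-free translation `r`. [folklore] -/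
def orbitPoly (P : MvPolynomial (Option β × ThetaIdx γ δ) ℂ) (w r : β ⊕ (γ ⊕ δ) → ℂ)
    (μ : (Option β × ThetaIdx γ δ) →₀ ℕ) : Polynomial ℂ :=
  Polynomial.C (P.coeff μ) *
    ∏ J ∈ μ.support, (Polynomial.C (theta L κM J w) + Polynomial.X * Polynomial.C (slope L κM r w J)) ^ μ J

/-- The torus character value `α_μ = exp(∑_j m_μ(j) y'_j(r))` of a monomial along `r`. [folklore] -/
def orbitChar (r : β ⊕ (γ ⊕ δ) → ℂ) (μ : (Option β × ThetaIdx γ δ) →₀ ℕ) : ℂ :=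
  cexp (∑ j, (yWeight μ j : ℂ) * r (iy j))

omit [Fintype γ] [Fintype δ] [DecidableEq γ] in
/-- `α_μ ≠ 0`. [folklore] -/
theorem orbitChar_ne_zero (r : β ⊕ (γ ⊕ δ) → ℂ) (μ : (Option β × ThetaIdx γ δ) →₀ ℕ) :
    orbitChar (γ := γ) (δ := δ) r μ ≠ 0 :=
  exp_ne_zero _

omit [Fintype β] [Fintype δ] in
/-- The degree of `Q_μ` is at most `|μ|`. [folklore] -/
theorem natDegree_orbitPoly_le (P : MvPolynomial (Option β × ThetaIdx γ δ) ℂ) (w r : β ⊕ (γ ⊕ δ) → ℂ)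
    (μ : (Option β × ThetaIdx γ δ) →₀ ℕ) :
    (orbitPoly L κM P w r μ).natDegree ≤ μ.degree := by
  unfold orbitPoly
  refine (Polynomial.natDegree_C_mul_le _ _).trans ?_
  refine (Polynomial.natDegree_prod_le _ _).trans ?_
  rw [Finsupp.degree]
  refine Finset.sum_le_sum fun J _ => ?_
  refine (Polynomial.natDegree_pow_le).trans ?_
  have : (Polynomial.C (theta L κM J w) + Polynomial.X * Polynomial.C (slope L κM r w J)).natDegree ≤ 1 := by
    refine (Polynomial.natDegree_add_le _ _).trans ?_
    rw [Polynomial.natDegree_C, Nat.zero_max]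
    calc (Polynomial.X * Polynomial.C (slope L κM r w J)).natDegree
        ≤ Polynomial.X.natDegree + (Polynomial.C (slope L κM r w J)).natDegree :=
          Polynomial.natDegree_mul_le
      _ ≤ 1 := by rw [Polynomial.natDegree_C, add_zero]; exact Polynomial.natDegree_X_le
  calc μ J * (Polynomial.C (theta L κM J w) + Polynomial.X * Polynomial.C (slope L κM r w J)).natDegree
      ≤ μ J * 1 := Nat.mul_le_mul_left _ this
    _ = μ J := mul_one _

omit [Fintype δ] in
/-- **`F_P` along a general `z'`-free translation**, monomial by monomial:
`F_P(w + v) = ∑_μ exp(∑_j m_μ(j) y'_j(v)) · Q_μ(τ)` whenever `s(v) = τ s(r)`. [folklore] -/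
theorem thetaEval_add_of_z (P : MvPolynomial (Option β × ThetaIdx γ δ) ℂ) (w r v : β ⊕ (γ ⊕ δ) → ℂ)
    (hv : ∀ b, v (iz b) = 0) (τ : ℂ) (hs : ∀ e, v (is e) = τ * r (is e)) :
    thetaEval L κM P (w + v) =
      ∑ μ ∈ P.support, cexp (∑ j, (yWeight μ j : ℂ) * v (iy j)) * (orbitPoly L κM P w r μ).eval τ := by
  classical
  rw [thetaEval, MvPolynomial.eval_eq]
  refine Finset.sum_congr rfl fun μ _ => ?_
  have hθ : ∀ J, theta L κM J (w + v) = thetaT J.1 v * (theta L κM J w + τ * slope L κM r w J) := by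
    intro J
    rw [theta_add_of_z L κM J hv, slope_congr L κM v (τ • r) (fun e => by simp [hs e]) w J,
      slope_smul]
  simp only [hθ, mul_pow, Finset.prod_mul_distrib, prod_thetaT_pow]
  rw [orbitPoly, Polynomial.eval_mul, Polynomial.eval_C, Polynomial.eval_prod]
  simp only [Polynomial.eval_pow, Polynomial.eval_add, Polynomial.eval_C, Polynomial.eval_mul,
    Polynomial.eval_X]
  ring

omit [Fintype δ] in
/-- **`F_P` along the orbit `w + ℕ r`** (`z'(r) = 0`) is an exponential polynomial:
`F_P(w + n r) = ∑_μ α_μ^n Q_μ(n)`. [folklore] -/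
theorem thetaEval_add_natMul (P : MvPolynomial (Option β × ThetaIdx γ δ) ℂ) (w r : β ⊕ (γ ⊕ δ) → ℂ)
    (hr : ∀ b, r (iz b) = 0) (n : ℕ) :
    thetaEval L κM P (w + (n : ℂ) • r) =
      ∑ μ ∈ P.support, orbitChar r μ ^ n * (orbitPoly L κM P w r μ).eval (n : ℂ) := by
  rw [thetaEval_add_of_z L κM P w r ((n : ℂ) • r) (fun b => by simp [hr b]) n (fun e => by simp)]
  refine Finset.sum_congr rfl fun μ _ => ?_
  congr 1
  rw [orbitChar, ← exp_nat_mul, Finset.mul_sum]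
  congr 1
  refine Finset.sum_congr rfl fun j _ => ?_
  simp only [Pi.smul_apply, smul_eq_mul]
  ring

/-! ### The periodicity (orbit-closure) lemma -/

omit [Fintype γ] [Fintype δ] [DecidableEq γ] in
/-- Monomials with the same character along `r` have the same character along every `θ`
orthogonal to the integer relations of `y'(r)` modulo `2πiℤ`. [folklore] -/
theorem exp_yWeight_eq_of_orbitChar_eq {r : β ⊕ (γ ⊕ δ) → ℂ} {θ : β → ℂ}
    (hθ : ∀ q : β → ℤ, cexp (∑ j, (q j : ℂ) * r (iy j)) = 1 → ∑ j, (q j : ℂ) * θ j = 0)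
    {μ μ' : (Option β × ThetaIdx γ δ) →₀ ℕ} (h : orbitChar (γ := γ) (δ := δ) r μ = orbitChar r μ') :
    cexp (∑ j, (yWeight μ j : ℂ) * θ j) = cexp (∑ j, (yWeight μ' j : ℂ) * θ j) := by
  have hq := hθ (fun j => (yWeight μ j : ℤ) - (yWeight μ' j : ℤ)) (by
    have e : ∑ j, (((yWeight μ j : ℤ) - (yWeight μ' j : ℤ) : ℤ) : ℂ) * r (iy j) =
        ∑ j, (yWeight μ j : ℂ) * r (iy j) - ∑ j, (yWeight μ' j : ℂ) * r (iy j) := by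
      rw [← Finset.sum_sub_distrib]
      refine Finset.sum_congr rfl fun j _ => ?_
      push_cast; ring
    rw [e, exp_sub, div_eq_one_iff_eq (exp_ne_zero _)]
    exact h)
  have e : ∑ j, (((yWeight μ j : ℤ) - (yWeight μ' j : ℤ) : ℤ) : ℂ) * θ j =
      ∑ j, (yWeight μ j : ℂ) * θ j - ∑ j, (yWeight μ' j : ℂ) * θ j := by
    rw [← Finset.sum_sub_distrib]
    refine Finset.sum_congr rfl fun j _ => ?_
    push_cast; ring
  rw [e, sub_eq_zero] at hq
  rw [hq]

omit [Fintype δ] in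
/-- **Periodicity (orbit-closure) lemma.** Let `r ∈ V` have vanishing `E`-coordinates. If `F_P`
vanishes at `w + n r` for every `n ∈ ℕ`, then `F_P` vanishes at `w + (θ, 0, τ s(r))` for every
`τ ∈ ℂ` and every `θ ∈ ℂ^β` orthogonal to all `q ∈ ℤ^β` with `e^{⟨q, y'(r)⟩} = 1`: the Zariski
closure of the orbit `w + ℕ r` contains these translates (the connected algebraic hull of `r`
translated to `w`). Proof: `F_P(w + n r) = ∑_α α^n R_α(n)` with distinct non-zero `α` forces all
`R_α = 0` (Baker's generalised Vandermonde lemma), and `F_P(w + (θ, 0, τ s(r))) = ∑_α e^{⟨m_α,θ⟩} R_α(τ)`.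
[cite: BakerTNT1975, Ch. 3 §2 Lemma 3] -/
theorem thetaEval_eq_zero_of_forall_natMul (P : MvPolynomial (Option β × ThetaIdx γ δ) ℂ)
    {w r : β ⊕ (γ ⊕ δ) → ℂ} (hr : ∀ b, r (iz b) = 0)
    (h : ∀ n : ℕ, thetaEval L κM P (w + (n : ℂ) • r) = 0)
    {θ : β → ℂ} (hθ : ∀ q : β → ℤ, cexp (∑ j, (q j : ℂ) * r (iy j)) = 1 → ∑ j, (q j : ℂ) * θ j = 0)
    (τ : ℂ) : thetaEval L κM P (w + coords θ 0 (fun e => τ * r (is e))) = 0 := by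
  classical
  -- the distinct characters
  set S := P.support with hS
  set A := S.image (orbitChar (γ := γ) (δ := δ) r) with hA
  -- the grouped polynomials `R_a = ∑_{α_μ = a} Q_μ`
  set R : ℂ → Polynomial ℂ := fun a => ∑ μ ∈ S with orbitChar (γ := γ) (δ := δ) r μ = a,
    orbitPoly L κM P w r μ with hR
  -- Step 1: `∑_{a ∈ A} R_a(n) a^n = F_P(w + n r) = 0`
  have hsum : ∀ n : ℕ, ∑ a ∈ A, (R a).eval (n : ℂ) * a ^ n = 0 := by
    intro n
    rw [← h n, thetaEval_add_natMul L κM P w r hr n, hA,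
      ← Finset.sum_fiberwise_of_maps_to (s := S) (t := S.image (orbitChar r))
        (g := orbitChar (γ := γ) (δ := δ) r) (fun μ hμ => Finset.mem_image_of_mem _ hμ)]
    refine Finset.sum_congr rfl fun a _ => ?_
    rw [hR]
    simp only [Polynomial.eval_finsetSum, Finset.sum_mul]
    refine Finset.sum_congr rfl fun μ hμ => ?_
    rw [Finset.mem_filter] at hμ
    rw [hμ.2, mul_comm]
  -- Step 2: all `R_a = 0` (generalised Vandermonde)
  have hRzero : ∀ a ∈ A, R a = 0 := by
    set D := P.totalDegree + 1 with hD
    have hdeg : ∀ a : A, R a = 0 ∨ (R a).natDegree < D := by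
      intro a
      right
      rw [hR]
      refine lt_of_le_of_lt (Polynomial.natDegree_sum_le_of_forall_le _ _ fun μ hμ => ?_)
        (Nat.lt_succ_self _)
      rw [Finset.mem_filter] at hμ
      exact (natDegree_orbitPoly_le L κM P w r μ).trans (MvPolynomial.le_totalDegree hμ.1)
    have hall := Baker1975.Ch3.ExpPoly.eq_zero_of_esum_eq_zero (A := A) (fun a => (a : ℂ))
      Subtype.val_injective (fun a => by
        obtain ⟨a, ha⟩ := a
        rw [hA, Finset.mem_image] at ha
        obtain ⟨μ, _, rfl⟩ := ha
        exact orbitChar_ne_zero r μ) (fun a => R a) hdeg (fun i _ => by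
        rw [← hsum i]
        exact (Finset.sum_coe_sort A (fun a => (R a).eval (i : ℂ) * a ^ i)))
    intro a ha
    exact hall ⟨a, ha⟩
  -- Step 3: `F_P(w + (θ, 0, τ s(r))) = ∑_a e^{⟨m_a, θ⟩} R_a(τ) = 0`
  rw [thetaEval_add_of_z L κM P w r (coords θ 0 fun e => τ * r (is e)) (fun b => by simp) τ
    (fun e => by simp)]
  rw [← Finset.sum_fiberwise_of_maps_to (s := S) (t := A) (g := orbitChar (γ := γ) (δ := δ) r)
    (fun μ hμ => Finset.mem_image_of_mem _ hμ)]
  refine Finset.sum_eq_zero fun a ha => ?_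
  -- on the fibre of `a`, the `θ`-character is constant
  obtain ⟨μ₀, hμ₀S, hμ₀⟩ := Finset.mem_image.mp ha
  have hconst : ∀ μ ∈ S.filter (fun μ => orbitChar (γ := γ) (δ := δ) r μ = a),
      cexp (∑ j, (yWeight μ j : ℂ) * (coords θ (0 : γ → ℂ) (fun e => τ * r (is e))) (iy j)) =
        cexp (∑ j, (yWeight μ₀ j : ℂ) * θ j) := by
    intro μ hμ
    rw [Finset.mem_filter] at hμ
    simp only [coords_iy]
    exact exp_yWeight_eq_of_orbitChar_eq hθ (hμ.2.trans hμ₀.symm)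
  calc ∑ μ ∈ S.filter (fun μ => orbitChar r μ = a),
        cexp (∑ j, (yWeight μ j : ℂ) * (coords θ (0 : γ → ℂ) (fun e => τ * r (is e))) (iy j)) *
          (orbitPoly L κM P w r μ).eval τ
      = ∑ μ ∈ S.filter (fun μ => orbitChar r μ = a),
          cexp (∑ j, (yWeight μ₀ j : ℂ) * θ j) * (orbitPoly L κM P w r μ).eval τ :=
        Finset.sum_congr rfl fun μ hμ => by rw [hconst μ hμ]
    _ = cexp (∑ j, (yWeight μ₀ j : ℂ) * θ j) * (R a).eval τ := by
        rw [hR]; simp only [Polynomial.eval_finsetSum, Finset.mul_sum]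
    _ = 0 := by rw [hRzero a ha]; simp

/-! ### Translations with lattice `E`-coordinates -/

omit [Fintype β] [Fintype δ] [DecidableEq γ] in
/-- The kernel vector over a lattice vector `λ = (m_b ω₁ + n_b ω₂)_b`:
`(0; λ; (∑_b κ_{eb} η(λ_b))_e) ∈ ker(exp_{M_κ})`. [folklore] -/
theorem coords_lattice_mem_ker (m n : γ → ℤ) :
    coords (0 : β → ℂ) (fun b => (m b : ℂ) * L.ω₁ + (n b : ℂ) * L.ω₂)
      (fun e => ∑ b, (κM e b : ℂ) * ((m b : ℂ) * L.η₁ + (n b : ℂ) * L.η₂)) ∈ ker L κM :=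
  ⟨fun j => ⟨0, by simp⟩, m, n, fun b => by simp, fun e => by simp⟩

/-- For a FORM `P`, `F_P(x + k) = 0 ↔ F_P(x) = 0` for `k ∈ ker(exp_{M_κ})` (automorphy). [folklore] -/
theorem thetaEval_add_ker_eq_zero_iff {P : MvPolynomial (Option β × ThetaIdx γ δ) ℂ}
    {D : ℕ} (hP : P.IsHomogeneous D) {k : β ⊕ (γ ⊕ δ) → ℂ} (hk : k ∈ ker L κM) (x : β ⊕ (γ ⊕ δ) → ℂ) :
    thetaEval L κM P (x + k) = 0 ↔ thetaEval L κM P x = 0 := by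
  rw [← vanishesAlong_one_iff ⊤ (thetaEval L κM P) (x + k), ← vanishesAlong_one_iff ⊤ (thetaEval L κM P) x]
  exact vanishesAlong_add_ker_iff L κM hP ⊤ hk x 1

/-- **Periodicity lemma, lattice version.** Let `P` be a form vanishing on `X ⊆ V`, and `t ∈ V` a
translation with lattice `E`-coordinates `z'_b(t) = m_b ω₁ + n_b ω₂` such that the orbit `w + ℕ t`
stays in `X`. Then `F_P` vanishes at `w + (θ, 0, τ c)` for all `τ ∈ ℂ` and all `θ` orthogonal to
the integer relations `q` with `e^{⟨q, y'(t)⟩} = 1`, where `c = s(t) - (∑_b κ_{eb} η(z'_b(t)))_e`: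
subtracting the kernel vector over `z'(t)` (automorphy of `Θ`, `GaGmE.Std.exists_theta_add_ker`)
reduces to `thetaEval_eq_zero_of_forall_natMul`. [folklore] -/
theorem thetaEval_eq_zero_of_forall_natMul_lattice {P : MvPolynomial (Option β × ThetaIdx γ δ) ℂ}
    {D : ℕ} (hP : P.IsHomogeneous D) {X : Set (β ⊕ (γ ⊕ δ) → ℂ)}
    (hX : ∀ x ∈ X, thetaEval L κM P x = 0) {t : β ⊕ (γ ⊕ δ) → ℂ} (m n : γ → ℤ)
    (ht : ∀ b, t (iz b) = (m b : ℂ) * L.ω₁ + (n b : ℂ) * L.ω₂) {w : β ⊕ (γ ⊕ δ) → ℂ}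
    (hw : ∀ k : ℕ, w + (k : ℂ) • t ∈ X) {θ : β → ℂ}
    (hθ : ∀ q : β → ℤ, cexp (∑ j, (q j : ℂ) * t (iy j)) = 1 → ∑ j, (q j : ℂ) * θ j = 0) (τ : ℂ) :
    thetaEval L κM P (w + coords θ 0 (fun e =>
      τ * (t (is e) - ∑ b, (κM e b : ℂ) * ((m b : ℂ) * L.η₁ + (n b : ℂ) * L.η₂)))) = 0 := by
  set k₀ : β ⊕ (γ ⊕ δ) → ℂ := coords (0 : β → ℂ) (fun b => (m b : ℂ) * L.ω₁ + (n b : ℂ) * L.ω₂)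
      (fun e => ∑ b, (κM e b : ℂ) * ((m b : ℂ) * L.η₁ + (n b : ℂ) * L.η₂)) with hk₀
  have hk₀mem : k₀ ∈ ker L κM := coords_lattice_mem_ker L κM m n
  set r := t - k₀ with hr
  have hrz : ∀ b, r (iz b) = 0 := fun b => by simp [hr, hk₀, ht b]
  have hry : ∀ j, r (iy j) = t (iy j) := fun j => by simp [hr, hk₀]
  have hrs : ∀ e, r (is e) = t (is e) - ∑ b, (κM e b : ℂ) * ((m b : ℂ) * L.η₁ + (n b : ℂ) * L.η₂) :=
    fun e => by simp [hr, hk₀]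
  -- the orbit along `r` is the orbit along `t` shifted by kernel vectors
  have horb : ∀ k : ℕ, thetaEval L κM P (w + (k : ℂ) • r) = 0 := by
    intro k
    have e : w + (k : ℂ) • t = (w + (k : ℂ) • r) + (k : ℂ) • k₀ := by
      rw [hr, smul_sub]; abel
    have := hX _ (hw k)
    rwa [e, thetaEval_add_ker_eq_zero_iff L κM hP (natCast_smul_mem_ker L κM hk₀mem k)] at this
  have := thetaEval_eq_zero_of_forall_natMul L κM P hrz horb (θ := θ)
    (fun q hq => hθ q (by simpa only [hry] using hq)) τ
  simpa only [hrs] using this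

/-! ### Pure torus translations: Artin's independence of characters -/

/-- The `y'`-directions orthogonal to the integer relations modulo `2πiℤ` of an additive subgroup
`Γ ≤ ℂ^β`: `{θ ; ∀ q ∈ ℤ^β, (∀ g ∈ Γ, e^{⟨q,g⟩} = 1) → ⟨q, θ⟩ = 0}` — the Lie algebra of the
smallest algebraic subgroup of `𝔾ₘ^β` containing `exp(Γ)`. [folklore] -/
def charPerp (Γ : AddSubgroup (β → ℂ)) : Submodule ℂ (β → ℂ) where
  carrier := {θ | ∀ q : β → ℤ, (∀ g ∈ Γ, cexp (∑ j, (q j : ℂ) * g j) = 1) → ∑ j, (q j : ℂ) * θ j = 0}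
  zero_mem' := fun q _ => by simp
  add_mem' := by
    intro θ θ' hθ hθ' q hq
    simp only [Pi.add_apply, mul_add, Finset.sum_add_distrib, hθ q hq, hθ' q hq, add_zero]
  smul_mem' := by
    intro c θ hθ q hq
    simp only [Pi.smul_apply, smul_eq_mul, mul_left_comm _ c, ← Finset.mul_sum, hθ q hq, mul_zero]

omit [Fintype γ] [Fintype δ] [DecidableEq γ] in
/-- Membership in `charPerp`. [folklore] -/
theorem mem_charPerp_iff {Γ : AddSubgroup (β → ℂ)} {θ : β → ℂ} :
    θ ∈ charPerp (β := β) Γ ↔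
      ∀ q : β → ℤ, (∀ g ∈ Γ, cexp (∑ j, (q j : ℂ) * g j) = 1) → ∑ j, (q j : ℂ) * θ j = 0 :=
  Iff.rfl

omit [Fintype γ] [Fintype δ] [DecidableEq γ] in
/-- The character `g ↦ e^{⟨m, g⟩}` of `Γ` attached to `m ∈ ℕ^β`. [folklore] -/
def charHom (Γ : AddSubgroup (β → ℂ)) (m : β → ℕ) : Multiplicative Γ →* ℂ where
  toFun x := cexp (∑ j, (m j : ℂ) * (x.toAdd : β → ℂ) j)
  map_one' := by simp
  map_mul' x x' := by
    rw [← exp_add, ← Finset.sum_add_distrib]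
    congr 1
    refine Finset.sum_congr rfl fun j _ => ?_
    simp only [toAdd_mul, AddSubgroup.coe_add, Pi.add_apply]
    ring

omit [Fintype γ] [Fintype δ] [DecidableEq γ] in
/-- Unfolding `charHom`. [folklore] -/
@[simp] theorem charHom_apply (Γ : AddSubgroup (β → ℂ)) (m : β → ℕ) (x : Multiplicative Γ) :
    charHom Γ m x = cexp (∑ j, (m j : ℂ) * (x.toAdd : β → ℂ) j) := rfl

omit [Fintype δ] in
/-- **Artin move.** If `F_P` vanishes at `w + (g, 0, 0)` for all `g` in an additive subgroup
`Γ ≤ ℂ^β`, then it vanishes at `w + (θ, 0, 0)` for all `θ ∈ charPerp Γ`: on these translates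
`F_P` is a linear combination of the characters `e^{⟨m_μ, ·⟩}` of `Γ`, distinct characters are
linearly independent (Dedekind–Artin), and characters equal on `Γ` are equal at `θ`.
[folklore] -/
theorem thetaEval_eq_zero_of_forall_mem_addSubgroup (P : MvPolynomial (Option β × ThetaIdx γ δ) ℂ)
    {w : β ⊕ (γ ⊕ δ) → ℂ} (Γ : AddSubgroup (β → ℂ))
    (h : ∀ g ∈ Γ, thetaEval L κM P (w + coords g 0 0) = 0) {θ : β → ℂ} (hθ : θ ∈ charPerp Γ) :
    thetaEval L κM P (w + coords θ 0 0) = 0 := by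
  classical
  -- `F_P(w + (g, 0, 0)) = ∑_μ e^{⟨m_μ, g⟩} c_μ`
  set c : ((Option β × ThetaIdx γ δ) →₀ ℕ) → ℂ := fun μ => (orbitPoly L κM P w 0 μ).eval 0 with hc
  have hexp : ∀ g : β → ℂ, thetaEval L κM P (w + coords g 0 0) =
      ∑ μ ∈ P.support, cexp (∑ j, (yWeight μ j : ℂ) * g j) * c μ := by
    intro g
    rw [thetaEval_add_of_z L κM P w 0 (coords g 0 0) (fun b => by simp) 0 (fun e => by simp)]
    simp only [coords_iy, hc]
  -- group the monomials by their character on `Γ`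
  set S := P.support with hS
  set Φ : ((Option β × ThetaIdx γ δ) →₀ ℕ) → (Multiplicative Γ →* ℂ) := fun μ => charHom Γ (yWeight μ)
    with hΦ
  set T := S.image Φ with hT
  set a : (Multiplicative Γ →* ℂ) → ℂ := fun f => ∑ μ ∈ S with Φ μ = f, c μ with ha
  -- the linear combination `∑_{f ∈ T} a_f • f` vanishes on `Γ`
  have hcomb : ∑ f ∈ T, a f • (f : Multiplicative Γ → ℂ) = 0 := by
    funext x
    simp only [Finset.sum_apply, Pi.smul_apply, smul_eq_mul, Pi.zero_apply]
    have hx := h (x.toAdd : β → ℂ) (x.toAdd).2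
    rw [hexp] at hx
    rw [← hx, ← Finset.sum_fiberwise_of_maps_to (s := S) (t := T) (g := Φ)
      (fun μ hμ => Finset.mem_image_of_mem _ hμ)]
    refine Finset.sum_congr rfl fun f hf => ?_
    rw [ha, Finset.sum_mul]
    refine Finset.sum_congr rfl fun μ hμ => ?_
    rw [Finset.mem_filter] at hμ
    rw [← hμ.2, hΦ, charHom_apply, mul_comm]
  have hzero : ∀ f ∈ T, a f = 0 :=
    linearIndependent_iff'.mp (linearIndependent_monoidHom (Multiplicative Γ) ℂ) T a hcomb
  -- evaluate at `θ`
  rw [hexp, ← Finset.sum_fiberwise_of_maps_to (s := S) (t := T) (g := Φ)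
    (fun μ hμ => Finset.mem_image_of_mem _ hμ)]
  refine Finset.sum_eq_zero fun f hf => ?_
  obtain ⟨μ₀, hμ₀S, hμ₀⟩ := Finset.mem_image.mp hf
  have hconst : ∀ μ ∈ S.filter (fun μ => Φ μ = f),
      cexp (∑ j, (yWeight μ j : ℂ) * θ j) = cexp (∑ j, (yWeight μ₀ j : ℂ) * θ j) := by
    intro μ hμ
    rw [Finset.mem_filter] at hμ
    have hΦeq : Φ μ = Φ μ₀ := hμ.2.trans hμ₀.symm
    -- the integer relation `m_μ - m_μ₀` is trivial on `Γ`, hence orthogonal to `θ`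
    have hq := (mem_charPerp_iff.mp hθ) (fun j => (yWeight μ j : ℤ) - (yWeight μ₀ j : ℤ)) (by
      intro g hg
      have := congrArg (fun F : Multiplicative Γ →* ℂ => F (Multiplicative.ofAdd ⟨g, hg⟩)) hΦeq
      simp only [hΦ, charHom_apply, toAdd_ofAdd] at this
      have e : ∑ j, (((yWeight μ j : ℤ) - (yWeight μ₀ j : ℤ) : ℤ) : ℂ) * g j =
          ∑ j, (yWeight μ j : ℂ) * g j - ∑ j, (yWeight μ₀ j : ℂ) * g j := by
        rw [← Finset.sum_sub_distrib]
        refine Finset.sum_congr rfl fun j _ => ?_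
        push_cast; ring
      rw [e, exp_sub, div_eq_one_iff_eq (exp_ne_zero _)]
      exact this)
    have e : ∑ j, (((yWeight μ j : ℤ) - (yWeight μ₀ j : ℤ) : ℤ) : ℂ) * θ j =
        ∑ j, (yWeight μ j : ℂ) * θ j - ∑ j, (yWeight μ₀ j : ℂ) * θ j := by
      rw [← Finset.sum_sub_distrib]
      refine Finset.sum_congr rfl fun j _ => ?_
      push_cast; ring
    rw [e, sub_eq_zero] at hq
    rw [hq]
  calc ∑ μ ∈ S.filter (fun μ => Φ μ = f), cexp (∑ j, (yWeight μ j : ℂ) * θ j) * c μ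
      = ∑ μ ∈ S.filter (fun μ => Φ μ = f), cexp (∑ j, (yWeight μ₀ j : ℂ) * θ j) * c μ :=
        Finset.sum_congr rfl fun μ hμ => by rw [hconst μ hμ]
    _ = cexp (∑ j, (yWeight μ₀ j : ℂ) * θ j) * a f := by rw [ha, Finset.mul_sum]
    _ = 0 := by rw [hzero f hf, mul_zero]

/-! ### Block projections -/

/-- The `y'`-block of `w`. [folklore] -/
def yPart (w : β ⊕ (γ ⊕ δ) → ℂ) : β → ℂ := fun j => w (iy j)
/-- The `z'`-block of `w`. [folklore] -/
def zPart (w : β ⊕ (γ ⊕ δ) → ℂ) : γ → ℂ := fun b => w (iz b)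
/-- The `s`-block of `w`. [folklore] -/
def sPart (w : β ⊕ (γ ⊕ δ) → ℂ) : δ → ℂ := fun e => w (is e)

omit [Fintype β] [Fintype γ] [Fintype δ] [DecidableEq γ] in
/-- Unfolding `yPart`. [folklore] -/
@[simp] theorem yPart_apply (w : β ⊕ (γ ⊕ δ) → ℂ) (j : β) : yPart w j = w (iy j) := rfl
omit [Fintype β] [Fintype γ] [Fintype δ] [DecidableEq γ] in
/-- Unfolding `zPart`. [folklore] -/
@[simp] theorem zPart_apply (w : β ⊕ (γ ⊕ δ) → ℂ) (b : γ) : zPart w b = w (iz b) := rfl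
omit [Fintype β] [Fintype γ] [Fintype δ] [DecidableEq γ] in
/-- Unfolding `sPart`. [folklore] -/
@[simp] theorem sPart_apply (w : β ⊕ (γ ⊕ δ) → ℂ) (e : δ) : sPart w e = w (is e) := rfl

omit [Fintype β] [Fintype γ] [Fintype δ] [DecidableEq γ] in
/-- `w = (y'(w); z'(w); s(w))`. [folklore] -/
theorem coords_yPart_zPart_sPart (w : β ⊕ (γ ⊕ δ) → ℂ) : coords (yPart w) (zPart w) (sPart w) = w := by
  funext i
  rcases i with j | b | e <;> rfl

omit [Fintype β] [Fintype γ] [Fintype δ] [DecidableEq γ] in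
/-- Block decomposition `w = (y; 0; 0) + (0; z; 0) + (0; 0; s)`. [folklore] -/
theorem coords_eq_add_add (y : β → ℂ) (z : γ → ℂ) (s : δ → ℂ) :
    coords y z s = coords y 0 0 + coords 0 z 0 + coords 0 0 s := by
  funext i
  rcases i with j | b | e <;> simp [coords]

omit [Fintype β] [Fintype γ] [Fintype δ] [DecidableEq γ] in
/-- `coords` is additive. [folklore] -/
theorem coords_add (y y' : β → ℂ) (z z' : γ → ℂ) (s s' : δ → ℂ) :
    coords (y + y') (z + z') (s + s') = coords y z s + coords y' z' s' := by
  funext i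
  rcases i with j | b | e <;> simp [coords]

omit [Fintype β] [Fintype γ] [Fintype δ] [DecidableEq γ] in
/-- `coords` is homogeneous. [folklore] -/
theorem coords_smul (c : ℂ) (y : β → ℂ) (z : γ → ℂ) (s : δ → ℂ) :
    coords (c • y) (c • z) (c • s) = c • coords y z s := by
  funext i
  rcases i with j | b | e <;> simp [coords]

omit [Fintype β] [Fintype γ] [Fintype δ] [DecidableEq γ] in
/-- `coords` is subtractive. [folklore] -/
theorem coords_sub (y y' : β → ℂ) (z z' : γ → ℂ) (s s' : δ → ℂ) :
    coords (y - y') (z - z') (s - s') = coords y z s - coords y' z' s' := by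
  funext i
  rcases i with j | b | e <;> simp [coords]

/-- The linear embedding of the `y'`-block. [folklore] -/
def yEmb : (β → ℂ) →ₗ[ℂ] (β ⊕ (γ ⊕ δ) → ℂ) where
  toFun θ := coords θ 0 0
  map_add' θ θ' := by simpa using coords_add (γ := γ) (δ := δ) θ θ' 0 0 0 0
  map_smul' c θ := by simpa using coords_smul (γ := γ) (δ := δ) c θ 0 0

/-- The linear embedding of the `s`-block. [folklore] -/
def sEmb : (δ → ℂ) →ₗ[ℂ] (β ⊕ (γ ⊕ δ) → ℂ) where
  toFun σ := coords 0 0 σ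
  map_add' σ σ' := by simpa using coords_add (β := β) (γ := γ) 0 0 0 0 σ σ'
  map_smul' c σ := by simpa using coords_smul (β := β) (γ := γ) c 0 0 σ

omit [Fintype β] [Fintype γ] [Fintype δ] [DecidableEq γ] in
/-- Unfolding `yEmb`. [folklore] -/
@[simp] theorem yEmb_apply (θ : β → ℂ) : yEmb (γ := γ) (δ := δ) θ = coords θ 0 0 := rfl
omit [Fintype β] [Fintype γ] [Fintype δ] [DecidableEq γ] in
/-- Unfolding `sEmb`. [folklore] -/
@[simp] theorem sEmb_apply (σ : δ → ℂ) : sEmb (β := β) (γ := γ) σ = coords 0 0 σ := rfl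

/-! ### The algebraic hull datum of a subspace -/

section Hull

variable (𝔥 : Submodule ℂ (β ⊕ (γ ⊕ δ) → ℂ))

/-- The rational relations of the `y'`-projection of `𝔥`: `{q ∈ ℚ^β ; ⟨q, y'(w)⟩ = 0 ∀ w ∈ 𝔥}`
(the characters of `𝔾ₘ^β` whose Lie algebra contains `y'(𝔥)`). [folklore] -/
def yRel : Submodule ℚ (β → ℚ) where
  carrier := {q | ∀ w ∈ 𝔥, ∑ j, (q j : ℂ) * w (iy j) = 0}
  zero_mem' := fun w _ => by simp
  add_mem' := by
    intro q q' hq hq' w hw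
    simp only [Pi.add_apply, Rat.cast_add, add_mul, Finset.sum_add_distrib, hq w hw, hq' w hw, add_zero]
  smul_mem' := by
    intro c q hq w hw
    simp only [Pi.smul_apply, smul_eq_mul, Rat.cast_mul, mul_assoc, ← Finset.mul_sum, hq w hw, mul_zero]

omit [Fintype γ] [Fintype δ] [DecidableEq γ] in
/-- Membership in `yRel`. [folklore] -/
theorem mem_yRel_iff {q : β → ℚ} : q ∈ yRel 𝔥 ↔ ∀ w ∈ 𝔥, ∑ j, (q j : ℂ) * w (iy j) = 0 := Iff.rfl

/-- `z' ≡ 0` on `𝔥` (the abelian projection of `exp(𝔥)` is trivial) — a predicate on subspaces,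
recorded as a one-field structure. [folklore] -/
structure ZFlat (𝔥 : Submodule ℂ (β ⊕ (γ ⊕ δ) → ℂ)) : Prop where
  /-- All `E`-coordinates vanish on `𝔥`. -/
  eq_zero : ∀ w ∈ 𝔥, ∀ b, w (iz b) = 0

omit [Fintype β] [Fintype γ] [Fintype δ] [DecidableEq γ] in
/-- Unfolding `ZFlat`. [folklore] -/
theorem zFlat_iff : ZFlat 𝔥 ↔ ∀ w ∈ 𝔥, ∀ b, w (iz b) = 0 :=
  ⟨fun h => h.eq_zero, fun h => ⟨h⟩⟩

/-- The linear forms on the `s`-block killing `s(𝔥)` and, when `z' ≢ 0` on `𝔥`, the columns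
`κ_{·b}` (the vector part of the hull must then contain the Lie image of the abelian part).
[folklore] -/
def sRel : Submodule ℂ (δ → ℂ) where
  carrier := {ξ | (∀ w ∈ 𝔥, ∑ e, ξ e * w (is e) = 0) ∧ (¬ ZFlat 𝔥 → ∀ b, ∑ e, ξ e * (κM e b : ℂ) = 0)}
  zero_mem' := ⟨fun w _ => by simp, fun _ b => by simp⟩
  add_mem' := by
    rintro ξ ξ' ⟨h1, h2⟩ ⟨h1', h2'⟩
    refine ⟨fun w hw => ?_, fun hz b => ?_⟩
    · simp only [Pi.add_apply, add_mul, Finset.sum_add_distrib, h1 w hw, h1' w hw, add_zero]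
    · simp only [Pi.add_apply, add_mul, Finset.sum_add_distrib, h2 hz b, h2' hz b, add_zero]
  smul_mem' := by
    rintro c ξ ⟨h1, h2⟩
    refine ⟨fun w hw => ?_, fun hz b => ?_⟩
    · simp only [Pi.smul_apply, smul_eq_mul, mul_assoc, ← Finset.mul_sum, h1 w hw, mul_zero]
    · simp only [Pi.smul_apply, smul_eq_mul, mul_assoc, ← Finset.mul_sum, h2 hz b, mul_zero]

omit [Fintype β] [Fintype γ] [DecidableEq γ] in
/-- Membership in `sRel`. [folklore] -/
theorem mem_sRel_iff {ξ : δ → ℂ} : ξ ∈ sRel κM 𝔥 ↔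
    (∀ w ∈ 𝔥, ∑ e, ξ e * w (is e) = 0) ∧ (¬ ZFlat 𝔥 → ∀ b, ∑ e, ξ e * (κM e b : ℂ) = 0) := Iff.rfl

omit [Fintype β] [Fintype γ] [Fintype δ] [DecidableEq γ] in
/-- The cast of a rational standard basis vector. [folklore] -/
theorem ratCast_single (b : γ) [DecidableEq γ] :
    (fun b' => ((Pi.single b (1 : ℚ) : γ → ℚ) b' : ℂ)) = Pi.single b (1 : ℂ) := by
  funext b'
  by_cases h : b' = b
  · subst h; simp
  · simp [h]

omit [Fintype β] [Fintype δ] [DecidableEq γ] in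
/-- The rational vectors span `ℂ^γ`. [folklore] -/
theorem span_ratCast_top :
    Submodule.span ℂ ((fun c : γ → ℚ => fun b => (c b : ℂ)) '' ((⊤ : Submodule ℚ (γ → ℚ)) : Set (γ → ℚ))) = ⊤ := by
  classical
  rw [eq_top_iff]
  rintro v -
  rw [← Finset.univ_sum_single v]
  refine Submodule.sum_mem _ fun b _ => ?_
  have e : (Pi.single b (v b) : γ → ℂ) = v b • (fun b' => ((Pi.single b (1 : ℚ) : γ → ℚ) b' : ℂ)) := by
    rw [ratCast_single]
    funext b'
    by_cases h : b' = b
    · subst h; simp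
    · simp [h]
  rw [e]
  exact Submodule.smul_mem _ _ (Submodule.subset_span ⟨Pi.single b 1, Submodule.mem_top, rfl⟩)

open Classical in
/-- **The algebraic hull datum of `𝔥`** (at most one elliptic factor): `A = yRel 𝔥`,
`C = ⊤` if `z' ≡ 0` on `𝔥` and `C = ⊥` otherwise, `Ξ = sRel 𝔥`; the compatibility
`ξ ∘ κ ∈ span C` holds by construction. Its `tangent` is the Lie algebra of the smallest connected
algebraic subgroup of `M_κ` whose Lie algebra contains `𝔥` (`thetaEval_eq_zero_on_hull`).
[folklore] -/
def hullData : SubgroupDataC β γ δ κM where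
  A := yRel 𝔥
  C := if ZFlat 𝔥 then ⊤ else ⊥
  Ξ := sRel κM 𝔥
  compat := by
    intro ξ hξ
    by_cases hz : ZFlat 𝔥
    · rw [if_pos hz, span_ratCast_top]
      exact Submodule.mem_top
    · have h0 : (fun b => ∑ e, ξ e * (κM e b : ℂ)) = 0 := funext fun b => (hξ.2 hz b)
      rw [h0]
      exact Submodule.zero_mem _

omit [DecidableEq γ] in
/-- The character datum of the hull. [folklore] -/
@[simp] theorem hullData_A : (hullData κM 𝔥).A = yRel 𝔥 := rfl

omit [DecidableEq γ] in
/-- The vector datum of the hull. [folklore] -/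
@[simp] theorem hullData_Ξ : (hullData κM 𝔥).Ξ = sRel κM 𝔥 := rfl

omit [DecidableEq γ] in
/-- The abelian datum of the hull when `z' ≡ 0` on `𝔥`: everything. [folklore] -/
theorem hullData_C_of_zFlat (hz : ZFlat 𝔥) : (hullData κM 𝔥).C = ⊤ := by
  classical
  show (if ZFlat 𝔥 then (⊤ : Submodule ℚ (γ → ℚ)) else ⊥) = ⊤
  rw [if_pos hz]

omit [DecidableEq γ] in
/-- The abelian datum of the hull when `z' ≢ 0` on `𝔥`: nothing. [folklore] -/
theorem hullData_C_of_not_zFlat (hz : ¬ ZFlat 𝔥) : (hullData κM 𝔥).C = ⊥ := by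
  classical
  show (if ZFlat 𝔥 then (⊤ : Submodule ℚ (γ → ℚ)) else ⊥) = ⊥
  rw [if_neg hz]

/-- Membership in the hull's Lie algebra. [folklore] -/
theorem mem_hull_tangent_iff {w : β ⊕ (γ ⊕ δ) → ℂ} : w ∈ (hullData κM 𝔥).tangent ↔
    (∀ q ∈ yRel 𝔥, ∑ j, (q j : ℂ) * w (iy j) = 0) ∧ (ZFlat 𝔥 → ∀ b, w (iz b) = 0) ∧
      (∀ ξ ∈ sRel κM 𝔥, ∑ e, ξ e * w (is e) = 0) := by
  classical
  rw [SubgroupDataC.mem_tangent_iff, hullData_A, hullData_Ξ]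
  refine and_congr Iff.rfl (and_congr ?_ Iff.rfl)
  by_cases hz : ZFlat 𝔥
  · rw [hullData_C_of_zFlat κM 𝔥 hz]
    simp only [hz, forall_true_left]
    constructor
    · intro h b
      have := h (Pi.single b 1) Submodule.mem_top
      simpa [Pi.single_apply, Finset.sum_ite_eq', apply_ite] using this
    · intro h c _
      simp [h]
  · rw [hullData_C_of_not_zFlat κM 𝔥 hz]
    simp only [hz, IsEmpty.forall_iff, iff_true]
    intro c hc
    rw [Submodule.mem_bot] at hc
    simp [hc]

/-- `𝔥 ≤ Lie(hull)`. [folklore] -/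
theorem le_hull_tangent : 𝔥 ≤ (hullData κM 𝔥).tangent := by
  intro w hw
  rw [mem_hull_tangent_iff]
  exact ⟨fun q hq => hq w hw, fun hz b => hz.eq_zero w hw b, fun ξ hξ => hξ.1 w hw⟩

end Hull

/-! ### Elementary lemmas for the hull computation -/

omit [Fintype β] [Fintype γ] [Fintype δ] [DecidableEq γ] in
/-- If `e^{ξ a} = 1` for every `ξ ∈ ℂ` then `a = 0`. [folklore] -/
theorem eq_zero_of_forall_exp_mul_eq_one {a : ℂ} (h : ∀ ξ : ℂ, cexp (ξ * a) = 1) : a = 0 := by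
  by_contra ha
  have := h (Real.pi * I / a)
  rw [div_mul_cancel₀ _ ha, exp_pi_mul_I] at this
  norm_num at this

omit [Fintype β] [Fintype γ] [Fintype δ] [DecidableEq γ] in
/-- **`ω₂/ω₁ ∉ ℚ`:** if `e^{(ω₁/ζ) a} = e^{(ω₂/ζ) a} = 1` then `a = 0`. [folklore] -/
theorem eq_zero_of_exp_period_mul_eq_one {ζ a : ℂ} (hζ : ζ ≠ 0)
    (h1 : cexp (L.ω₁ / ζ * a) = 1) (h2 : cexp (L.ω₂ / ζ * a) = 1) : a = 0 := by
  by_contra ha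
  obtain ⟨k₁, hk₁⟩ := Complex.exp_eq_one_iff.mp h1
  obtain ⟨k₂, hk₂⟩ := Complex.exp_eq_one_iff.mp h2
  have h2pi : (2 * Real.pi * I : ℂ) ≠ 0 := by simp [Real.pi_ne_zero, I_ne_zero]
  have hratio : L.ω₂ / L.ω₁ = (k₂ : ℂ) / k₁ := by
    have e : L.ω₂ / L.ω₁ = (L.ω₂ / ζ * a) / (L.ω₁ / ζ * a) := by
      rw [mul_div_mul_right _ _ ha, div_div_div_cancel_right₀ hζ]
    rw [e, hk₁, hk₂, mul_div_mul_right _ _ h2pi]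
  have him : (L.ω₂ / L.ω₁).im = 0 := by
    rw [hratio, show ((k₂ : ℂ) / k₁) = (((k₂ : ℝ) / k₁ : ℝ) : ℂ) by push_cast; rfl, ofReal_im]
  exact L.im_ω₂_div_ω₁_ne_zero him

omit [Fintype β] [Fintype γ] [Fintype δ] [DecidableEq γ] in
/-- **Legendre**: `ω₁η₂ - ω₂η₁ ≠ 0`. [cite: Waldschmidt2006] -/
theorem ω₁_mul_η₂_sub_ne_zero : L.ω₁ * L.η₂ - L.ω₂ * L.η₁ ≠ 0 := by
  have h2pi : (2 * Real.pi * I : ℂ) ≠ 0 := by simp [Real.pi_ne_zero, I_ne_zero]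
  rcases L.legendre_relation_or (fun L => L.legendre_relation_holds) with h | h
  · intro h0
    apply h2pi
    rw [← h]
    linear_combination (-1 : ℂ) * h0
  · intro h0
    apply h2pi
    rw [← h]
    linear_combination h0

omit [Fintype β] [Fintype γ] [Fintype δ] [DecidableEq γ] in
/-- A linear functional on `δ → ℂ` is the pairing with the vector of its values on the standard
basis. [folklore] -/
theorem dual_apply_eq_sum [Fintype δ] [DecidableEq δ] (f : Module.Dual ℂ (δ → ℂ)) (v : δ → ℂ) :
    f v = ∑ e, f (Pi.single e 1) * v e := by
  conv_lhs => rw [← Finset.univ_sum_single v]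
  rw [map_sum]
  refine Finset.sum_congr rfl fun e _ => ?_
  have : (Pi.single e (v e) : δ → ℂ) = v e • (Pi.single e (1 : ℂ) : δ → ℂ) := by
    funext e'
    by_cases h : e' = e
    · subst h; simp
    · simp [h]
  rw [this, map_smul, smul_eq_mul, mul_comm]

omit [Fintype β] [Fintype γ] [Fintype δ] [DecidableEq γ] in
/-- **Double orthogonal for the dot product**: a vector orthogonal to every linear form killing a
subspace `U ≤ ℂ^δ` lies in `U`. [folklore] -/
theorem mem_of_forall_dotPerp [Fintype δ] {U : Submodule ℂ (δ → ℂ)} {σ : δ → ℂ}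
    (h : ∀ ξ : δ → ℂ, (∀ u ∈ U, ∑ e, ξ e * u e = 0) → ∑ e, ξ e * σ e = 0) : σ ∈ U := by
  classical
  by_contra hσ
  obtain ⟨f, hfσ, hfU⟩ := Submodule.exists_dual_map_eq_bot_of_notMem hσ inferInstance
  apply hfσ
  rw [dual_apply_eq_sum]
  refine h (fun e => f (Pi.single e 1)) fun u hu => ?_
  rw [← dual_apply_eq_sum]
  have : f u ∈ U.map f := Submodule.mem_map_of_mem hu
  rw [hfU, Submodule.mem_bot] at this
  exact this

/-! ### Stability implies equality: the hull is reached -/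

section Stable

variable {L κM}

/-- The kernel-corrected `s`-vector of a translation with lattice `E`-coordinates
`z'_b(t) = m_b ω₁ + n_b ω₂`: `c(t) = s(t) - (∑_b κ_{eb} (m_b η₁ + n_b η₂))_e`. [folklore] -/
def cvec (L : PeriodPair) (κM : δ → γ → Kbar) (t : β ⊕ (γ ⊕ δ) → ℂ) (m n : γ → ℤ) : δ → ℂ :=
  fun e => t (is e) - ∑ b, (κM e b : ℂ) * ((m b : ℂ) * L.η₁ + (n b : ℂ) * L.η₂)

/-- The torus translations available at a stage `𝔥'`: the `g ∈ ℂ^β` with `(g; 0; 0) ∈ 𝔥' + ker`.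
[folklore] -/
def moveGroup (L : PeriodPair) (κM : δ → γ → Kbar) (𝔥' : Submodule ℂ (β ⊕ (γ ⊕ δ) → ℂ)) :
    AddSubgroup (β → ℂ) :=
  (𝔥'.toAddSubgroup ⊔ kerSubgroup L κM).comap (yEmb (γ := γ) (δ := δ)).toAddMonoidHom

omit [Fintype β] [Fintype δ] [DecidableEq γ] in
/-- Membership in `moveGroup`. [folklore] -/
theorem mem_moveGroup_iff {𝔥' : Submodule ℂ (β ⊕ (γ ⊕ δ) → ℂ)} {g : β → ℂ} :
    g ∈ moveGroup L κM 𝔥' ↔ ∃ h ∈ 𝔥', ∃ k ∈ ker L κM, h + k = coords g 0 0 := by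
  rw [moveGroup, AddSubgroup.mem_comap, AddSubgroup.mem_sup]
  simp only [LinearMap.toAddMonoidHom_coe, yEmb_apply, Submodule.mem_toAddSubgroup, mem_kerSubgroup]

/-- A form vanishing on `𝔥'` vanishes at `w + (g; 0; 0)` for `w ∈ 𝔥'`, `g ∈ moveGroup 𝔥'`.
[folklore] -/
theorem thetaEval_eq_zero_of_mem_moveGroup {P : MvPolynomial (Option β × ThetaIdx γ δ) ℂ} {D : ℕ}
    (hP : P.IsHomogeneous D) {𝔥' : Submodule ℂ (β ⊕ (γ ⊕ δ) → ℂ)}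
    (hvan : ∀ w ∈ 𝔥', thetaEval L κM P w = 0) {w : β ⊕ (γ ⊕ δ) → ℂ} (hw : w ∈ 𝔥')
    {g : β → ℂ} (hg : g ∈ moveGroup L κM 𝔥') : thetaEval L κM P (w + coords g 0 0) = 0 := by
  obtain ⟨h, hh, k, hk, hhk⟩ := mem_moveGroup_iff.mp hg
  rw [← hhk, ← add_assoc, thetaEval_add_ker_eq_zero_iff L κM hP hk]
  exact hvan _ (𝔥'.add_mem hw hh)

/-- **Stability lemma.** Let `|γ| ≤ 1`, `𝔥 ≤ 𝔥'`, and suppose `𝔥'` is stable under the two kinds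
of moves: the kernel-corrected `s`-vectors `(0; 0; c(t))` of its lattice-`z'` elements `t`, and the
torus directions `(θ; 0; 0)`, `θ ∈ charPerp (moveGroup 𝔥')`. Then `𝔥'` contains the Lie algebra of
the hull of `𝔥`. The Legendre relation frees the column of `κ` (when `z' ≢ 0` on `𝔥`) and
`ω₂/ω₁ ∉ ℝ` frees the rational hull of `y'(𝔥)`. [folklore] -/
theorem hull_tangent_le_of_stable (hγ : Fintype.card γ ≤ 1) {𝔥 𝔥' : Submodule ℂ (β ⊕ (γ ⊕ δ) → ℂ)}
    (h𝔥 : 𝔥 ≤ 𝔥')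
    (hS : ∀ t ∈ 𝔥', ∀ m n : γ → ℤ, (∀ b, t (iz b) = (m b : ℂ) * L.ω₁ + (n b : ℂ) * L.ω₂) →
      coords 0 0 (cvec L κM t m n) ∈ 𝔥')
    (hY : ∀ θ ∈ charPerp (moveGroup L κM 𝔥'), coords θ (0 : γ → ℂ) (0 : δ → ℂ) ∈ 𝔥') :
    (hullData κM 𝔥).tangent ≤ 𝔥' := by
  classical
  have hsub : ∀ b b' : γ, b = b' := fun b b' =>
    (Fintype.card_le_one_iff_subsingleton.mp hγ).elim b b'
  -- the column of `κ`
  set κvec : δ → ℂ := fun e => ∑ b, (κM e b : ℂ) with hκvec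
  /- Step 1: `s`-vectors of elements of `𝔥`, and the column of `κ`. -/
  have hs_flat : ∀ t ∈ 𝔥', (∀ b, t (iz b) = 0) → coords 0 0 (sPart t) ∈ 𝔥' := by
    intro t ht hz
    have := hS t ht 0 0 (fun b => by simp [hz b])
    have e : cvec L κM t 0 0 = sPart t := by
      funext e'; simp [cvec, sPart]
    rwa [e] at this
  -- scaling an element with `z'_{b₀} = ζ ≠ 0` to a lattice `z'`
  have hscale : ∀ t : β ⊕ (γ ⊕ δ) → ℂ, ∀ b₀, t (iz b₀) ≠ 0 → ∀ lam : ℂ, ∀ b,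
      ((lam / t (iz b₀)) • t) (iz b) = lam := by
    intro t b₀ hζ lam b
    rw [hsub b b₀]
    simp [div_mul_cancel₀ _ hζ]
  have hcvec_scale : ∀ t : β ⊕ (γ ⊕ δ) → ℂ, ∀ b₀, t (iz b₀) ≠ 0 → ∀ (lam η : ℂ) (m n : γ → ℤ),
      (∀ b, (m b : ℂ) * L.η₁ + (n b : ℂ) * L.η₂ = η) →
      cvec L κM ((lam / t (iz b₀)) • t) m n = (lam / t (iz b₀)) • sPart t - η • κvec := by
    intro t b₀ hζ lam η m n hη
    funext e
    simp only [cvec, Pi.smul_apply, smul_eq_mul, Pi.sub_apply, sPart_apply, hκvec, Finset.mul_sum]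
    congr 1
    refine Finset.sum_congr rfl fun b _ => ?_
    rw [hη b]; ring
  have hstep1 : ∀ t ∈ 𝔥', ∀ b₀, t (iz b₀) ≠ 0 →
      coords 0 0 κvec ∈ 𝔥' ∧ coords 0 0 (sPart t) ∈ 𝔥' := by
    intro t ht b₀ hζ
    set ζ := t (iz b₀) with hζdef
    have ht₁ : (L.ω₁ / ζ) • t ∈ 𝔥' := 𝔥'.smul_mem _ ht
    have ht₂ : (L.ω₂ / ζ) • t ∈ 𝔥' := 𝔥'.smul_mem _ ht
    have hu₁ := hS _ ht₁ 1 0 (fun b => by rw [hscale t b₀ hζ]; simp)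
    have hu₂ := hS _ ht₂ 0 1 (fun b => by rw [hscale t b₀ hζ]; simp)
    rw [hcvec_scale t b₀ hζ L.ω₁ L.η₁ 1 0 (fun b => by simp)] at hu₁
    rw [hcvec_scale t b₀ hζ L.ω₂ L.η₂ 0 1 (fun b => by simp)] at hu₂
    -- Legendre combination frees `κvec`
    have hκ : coords (0 : β → ℂ) (0 : γ → ℂ) ((L.ω₁ * L.η₂ - L.ω₂ * L.η₁) • κvec) ∈ 𝔥' := by
      have e : coords (0 : β → ℂ) (0 : γ → ℂ) ((L.ω₁ * L.η₂ - L.ω₂ * L.η₁) • κvec) =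
          L.ω₂ • coords (0 : β → ℂ) (0 : γ → ℂ) ((L.ω₁ / ζ) • sPart t - L.η₁ • κvec) -
            L.ω₁ • coords (0 : β → ℂ) (0 : γ → ℂ) ((L.ω₂ / ζ) • sPart t - L.η₂ • κvec) := by
        funext i
        rcases i with j | b | e
        · simp [coords]
        · simp [coords]
        · simp only [coords, Sum.elim_inr, Pi.smul_apply, Pi.sub_apply, smul_eq_mul]
          ring
      rw [e]
      exact 𝔥'.sub_mem (𝔥'.smul_mem _ hu₁) (𝔥'.smul_mem _ hu₂)
    have hκ' : coords (0 : β → ℂ) (0 : γ → ℂ) κvec ∈ 𝔥' := by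
      have e : coords (0 : β → ℂ) (0 : γ → ℂ) κvec =
          (L.ω₁ * L.η₂ - L.ω₂ * L.η₁)⁻¹ • coords (0 : β → ℂ) (0 : γ → ℂ) ((L.ω₁ * L.η₂ - L.ω₂ * L.η₁) • κvec) := by
        rw [← coords_smul, smul_zero, smul_zero, smul_smul, inv_mul_cancel₀ (ω₁_mul_η₂_sub_ne_zero L),
          one_smul]
      rw [e]; exact 𝔥'.smul_mem _ hκ
    refine ⟨hκ', ?_⟩
    -- then `s(t)` itself
    have hne : L.ω₁ / ζ ≠ 0 := div_ne_zero L.ω₁_ne_zero hζ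
    have e : (L.ω₁ / ζ) • coords (0 : β → ℂ) (0 : γ → ℂ) (sPart t) =
        coords (0 : β → ℂ) (0 : γ → ℂ) ((L.ω₁ / ζ) • sPart t - L.η₁ • κvec) +
          L.η₁ • coords (0 : β → ℂ) (0 : γ → ℂ) κvec := by
      funext i
      rcases i with j | b | e
      · simp [coords]
      · simp [coords]
      · simp only [coords, Sum.elim_inr, Pi.smul_apply, Pi.add_apply, Pi.sub_apply, smul_eq_mul, sPart_apply]
        ring
    rw [← 𝔥'.smul_mem_iff hne, e]
    exact 𝔥'.add_mem hu₁ (𝔥'.smul_mem _ hκ')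
  have hsAll : ∀ t ∈ 𝔥, coords 0 0 (sPart t) ∈ 𝔥' := by
    intro t ht
    by_cases hz : ∀ b, t (iz b) = 0
    · exact hs_flat t (h𝔥 ht) hz
    · push Not at hz
      obtain ⟨b₀, hb₀⟩ := hz
      exact (hstep1 t (h𝔥 ht) b₀ hb₀).2
  have hκ : ¬ ZFlat 𝔥 → coords (0 : β → ℂ) (0 : γ → ℂ) κvec ∈ 𝔥' := by
    intro hz
    rw [zFlat_iff] at hz
    simp only [not_forall] at hz
    obtain ⟨t, ht, b₀, hb₀⟩ := hz
    exact (hstep1 t (h𝔥 ht) b₀ hb₀).1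
  /- Step 2: the rational hull of `y'(𝔥)` through the move group. -/
  have hyGen : ∀ t ∈ 𝔥, (∀ b, t (iz b) = 0) → yPart t ∈ moveGroup L κM 𝔥' := by
    intro t ht hz
    rw [mem_moveGroup_iff]
    refine ⟨t - coords 0 0 (sPart t), 𝔥'.sub_mem (h𝔥 ht) (hsAll t ht), 0, zero_mem_ker L κM, ?_⟩
    rw [add_zero]
    funext i
    rcases i with j | b | e
    · simp [coords, yPart, iy]
    · simpa [coords, iz] using hz b
    · simp [coords, sPart, is]
  have hyGenLat : ∀ t ∈ 𝔥, ∀ b₀, t (iz b₀) ≠ 0 → ∀ (lam η : ℂ) (m n : γ → ℤ),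
      (∀ b, (m b : ℂ) * L.ω₁ + (n b : ℂ) * L.ω₂ = lam) → (∀ b, (m b : ℂ) * L.η₁ + (n b : ℂ) * L.η₂ = η) →
      (lam / t (iz b₀)) • yPart t ∈ moveGroup L κM 𝔥' := by
    intro t ht b₀ hζ lam η m n hlam hη
    set t' := (lam / t (iz b₀)) • t with ht'
    have ht'𝔥 : t' ∈ 𝔥' := 𝔥'.smul_mem _ (h𝔥 ht)
    have hzt' : ∀ b, t' (iz b) = (m b : ℂ) * L.ω₁ + (n b : ℂ) * L.ω₂ := fun b => by
      rw [ht', hscale t b₀ hζ, hlam b]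
    rw [mem_moveGroup_iff]
    refine ⟨t' - coords 0 0 (cvec L κM t' m n), 𝔥'.sub_mem ht'𝔥 (hS t' ht'𝔥 m n hzt'),
      -(coords (0 : β → ℂ) (fun b => (m b : ℂ) * L.ω₁ + (n b : ℂ) * L.ω₂)
        (fun e => ∑ b, (κM e b : ℂ) * ((m b : ℂ) * L.η₁ + (n b : ℂ) * L.η₂))),
      neg_mem_ker L κM (coords_lattice_mem_ker L κM m n), ?_⟩
    funext i
    rcases i with j | b | e
    · simp [coords, ht', yPart, iy]
    · simp only [coords, Pi.add_apply, Pi.sub_apply, Pi.neg_apply, Sum.elim_inr, Sum.elim_inl, Pi.zero_apply]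
      have := hzt' b
      simp only [iz] at this
      rw [this]; ring
    · simp only [coords, Pi.add_apply, Pi.sub_apply, Pi.neg_apply, Sum.elim_inr, Pi.zero_apply, cvec, is]
      ring
  have hyAll : ∀ θ : β → ℂ, (∀ q ∈ yRel 𝔥, ∑ j, (q j : ℂ) * θ j = 0) → coords θ (0 : γ → ℂ) (0 : δ → ℂ) ∈ 𝔥' := by
    intro θ hθ
    refine hY θ (mem_charPerp_iff.mpr fun q hq => ?_)
    -- the integer relation `q` of the move group is a rational relation of `y'(𝔥)`
    have hqRel : (fun j => (q j : ℚ)) ∈ yRel 𝔥 := by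
      intro t ht
      simp only [Rat.cast_intCast]
      set a := ∑ j, (q j : ℂ) * t (iy j) with ha
      by_cases hz : ∀ b, t (iz b) = 0
      · refine eq_zero_of_forall_exp_mul_eq_one fun ξ => ?_
        have hmem := hyGen (ξ • t) (𝔥.smul_mem _ ht) (fun b => by simp [hz b])
        have := hq _ hmem
        rw [← this, ha, Finset.mul_sum]
        congr 1
        refine Finset.sum_congr rfl fun j _ => ?_
        simp [yPart]; ring
      · push Not at hz
        obtain ⟨b₀, hζ⟩ := hz
        have h1 := hq _ (hyGenLat t ht b₀ hζ L.ω₁ L.η₁ 1 0 (fun b => by simp) (fun b => by simp))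
        have h2 := hq _ (hyGenLat t ht b₀ hζ L.ω₂ L.η₂ 0 1 (fun b => by simp) (fun b => by simp))
        have e : ∀ lam : ℂ, ∑ j, (q j : ℂ) * ((lam / t (iz b₀)) • yPart t) j = lam / t (iz b₀) * a := by
          intro lam
          rw [ha, Finset.mul_sum]
          refine Finset.sum_congr rfl fun j _ => ?_
          simp [yPart]; ring
        rw [e] at h1 h2
        exact eq_zero_of_exp_period_mul_eq_one L hζ h1 h2
    have := hθ _ hqRel
    simpa only [Rat.cast_intCast] using this
  /- Step 3: the `z'`-direction when `z' ≢ 0` on `𝔥`. -/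
  have hzAll : ¬ ZFlat 𝔥 → ∀ z : γ → ℂ, coords (0 : β → ℂ) z (0 : δ → ℂ) ∈ 𝔥' := by
    intro hz z
    rw [zFlat_iff] at hz
    simp only [not_forall] at hz
    obtain ⟨t, ht, b₀, hζ⟩ := hz
    have hzt : coords (0 : β → ℂ) (zPart t) (0 : δ → ℂ) ∈ 𝔥' := by
      have e : coords (0 : β → ℂ) (zPart t) (0 : δ → ℂ) = t - coords (yPart t) 0 0 - coords 0 0 (sPart t) := by
        funext i
        rcases i with j | b | e
        · simp [coords, yPart, iy]
        · simp [coords, zPart, iz]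
        · simp [coords, sPart, is]
      rw [e]
      refine 𝔥'.sub_mem (𝔥'.sub_mem (h𝔥 ht) (hyAll _ fun q hq => hq t ht)) (hsAll t ht)
    have e : coords (0 : β → ℂ) z (0 : δ → ℂ) = (z b₀ / t (iz b₀)) • coords (0 : β → ℂ) (zPart t) (0 : δ → ℂ) := by
      rw [← coords_smul, smul_zero, smul_zero]
      congr 1
      funext b
      rw [hsub b b₀]
      simp [div_mul_cancel₀ _ hζ]
    rw [e]
    exact 𝔥'.smul_mem _ hzt
  /- Assembly. -/
  intro w hw
  rw [mem_hull_tangent_iff] at hw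
  obtain ⟨hA, hC, hΞ⟩ := hw
  rw [← coords_yPart_zPart_sPart w, coords_eq_add_add]
  refine 𝔥'.add_mem (𝔥'.add_mem (hyAll _ hA) ?_) ?_
  · by_cases hz : ZFlat 𝔥
    · have : zPart w = 0 := funext (hC hz)
      rw [this]
      have h0 : coords (0 : β → ℂ) (0 : γ → ℂ) (0 : δ → ℂ) = 0 := by
        funext i; rcases i with j | b | e <;> simp [coords]
      rw [h0]; exact 𝔥'.zero_mem
    · exact hzAll hz _
  · -- the `s`-block by the double orthogonal
    have hmem : sPart w ∈ 𝔥'.comap (sEmb (β := β) (γ := γ)) := by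
      refine mem_of_forall_dotPerp fun ξ hξ => ?_
      have hξrel : ξ ∈ sRel κM 𝔥 := by
        refine ⟨fun t ht => ?_, fun hz b => ?_⟩
        · exact hξ (sPart t) (by simpa using hsAll t ht)
        · have e : (fun e => (κM e b : ℂ)) = κvec := by
            funext e
            rw [hκvec]
            simp only
            rw [Finset.sum_eq_single b (fun b' _ hb' => absurd (hsub b' b) hb') (fun h => absurd (Finset.mem_univ b) h)]
          have := hξ κvec (by simpa using hκ hz)
          simpa [← e] using this
      exact hΞ ξ hξrel
    exact hmem

end Stable

/-! ### The hull theorem -/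

section HullTheorem

variable {L κM}

omit [Fintype γ] [Fintype δ] [DecidableEq γ] in
/-- Clearing denominators: a rational vector is an integer vector divided by a non-zero integer.
[folklore] -/
theorem exists_int_vector_of_rat (q : β → ℚ) :
    ∃ N : ℤ, N ≠ 0 ∧ ∃ q' : β → ℤ, ∀ j, (q' j : ℚ) = N * q j := by
  classical
  refine ⟨∏ j, ((q j).den : ℤ), ?_, fun j => (∏ j' ∈ Finset.univ.erase j, ((q j').den : ℤ)) * (q j).num, ?_⟩
  · exact Finset.prod_ne_zero_iff.mpr fun j _ => by exact_mod_cast (q j).den_nz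
  · intro j
    rw [← Finset.prod_erase_mul _ _ (Finset.mem_univ j)]
    push_cast
    rw [mul_assoc]
    congr 1
    rw [mul_comm, Rat.mul_den_eq_num]

/-- The kernel-corrected `s`-vector of a lattice-`z'` element of `Lie(hull 𝔥)` lies in
`Lie(hull 𝔥)`. [folklore] -/
theorem coords_cvec_mem_hull {𝔥 : Submodule ℂ (β ⊕ (γ ⊕ δ) → ℂ)} {t : β ⊕ (γ ⊕ δ) → ℂ}
    (ht : t ∈ (hullData κM 𝔥).tangent) (m n : γ → ℤ)
    (hmn : ∀ b, t (iz b) = (m b : ℂ) * L.ω₁ + (n b : ℂ) * L.ω₂) :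
    coords 0 0 (cvec L κM t m n) ∈ (hullData κM 𝔥).tangent := by
  rw [mem_hull_tangent_iff] at ht ⊢
  obtain ⟨_, hC, hΞ⟩ := ht
  refine ⟨fun q _ => by simp [coords, iy], fun _ b => by simp [coords, iz], fun ξ hξ => ?_⟩
  simp only [coords, is, Sum.elim_inr, cvec, mul_sub, Finset.sum_sub_distrib]
  rw [show ∑ e, ξ e * t (Sum.inr (Sum.inr e)) = ∑ e, ξ e * t (is e) from rfl, hΞ ξ hξ, zero_sub,
    neg_eq_zero]
  by_cases hz : ZFlat 𝔥
  · -- all `z'_b(t) = 0`, so `m = n = 0`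
    have hmn0 : ∀ b, (m b : ℂ) * L.η₁ + (n b : ℂ) * L.η₂ = 0 := by
      intro b
      have h0' : (m b : ℝ) • L.ω₁ + (n b : ℝ) • L.ω₂ = 0 := by
        rw [Complex.real_smul, Complex.real_smul]
        push_cast
        rw [← hmn b]
        exact hC hz b
      obtain ⟨hm, hn⟩ := LinearIndependent.pair_iff.mp L.indep _ _ h0'
      have hm' : m b = 0 := by exact_mod_cast hm
      have hn' : n b = 0 := by exact_mod_cast hn
      simp [hm', hn']
    simp [hmn0]
  · have hκ := hξ.2 hz
    calc ∑ e, ξ e * ∑ b, (κM e b : ℂ) * ((m b : ℂ) * L.η₁ + (n b : ℂ) * L.η₂)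
        = ∑ b, ((m b : ℂ) * L.η₁ + (n b : ℂ) * L.η₂) * ∑ e, ξ e * (κM e b : ℂ) := by
          simp only [Finset.mul_sum]
          rw [Finset.sum_comm]
          refine Finset.sum_congr rfl fun b _ => Finset.sum_congr rfl fun e _ => ?_
          ring
      _ = 0 := Finset.sum_eq_zero fun b _ => by rw [hκ b, mul_zero]

/-- Torus directions orthogonal to the move group of a stage `𝔥' ≤ Lie(hull 𝔥)` lie in
`Lie(hull 𝔥)`. [folklore] -/
theorem coords_charPerp_mem_hull {𝔥 𝔥' : Submodule ℂ (β ⊕ (γ ⊕ δ) → ℂ)}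
    (h𝔥' : 𝔥' ≤ (hullData κM 𝔥).tangent) {θ : β → ℂ} (hθ : θ ∈ charPerp (moveGroup L κM 𝔥')) :
    coords θ (0 : γ → ℂ) (0 : δ → ℂ) ∈ (hullData κM 𝔥).tangent := by
  rw [mem_hull_tangent_iff]
  refine ⟨fun q hq => ?_, fun _ b => by simp [coords, iz], fun ξ _ => by simp [coords, is]⟩
  simp only [coords, iy, Sum.elim_inl]
  obtain ⟨N, hN, q', hq'⟩ := exists_int_vector_of_rat q
  -- the integer relation `q' = N q` is trivial on the move group
  have hq'Γ : ∀ g ∈ moveGroup L κM 𝔥', cexp (∑ j, (q' j : ℂ) * g j) = 1 := by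
    intro g hg
    obtain ⟨h, hh, k, hk, hhk⟩ := mem_moveGroup_iff.mp hg
    have hg' : ∀ j, g j = h (iy j) + k (iy j) := fun j => by
      have := congrFun hhk (iy j)
      simpa [coords, iy] using this.symm
    obtain ⟨hy, -, -, -, -⟩ := hk
    choose p hp using hy
    have hhA := ((mem_hull_tangent_iff κM 𝔥).mp (h𝔥' hh)).1 q hq
    have e : ∑ j, (q' j : ℂ) * g j = (∑ j, q' j * p j : ℤ) * (2 * Real.pi * I) := by
      simp only [hg', mul_add, Finset.sum_add_distrib]
      have e1 : ∑ j, (q' j : ℂ) * h (iy j) = N * ∑ j, (q j : ℂ) * h (iy j) := by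
        rw [Finset.mul_sum]
        refine Finset.sum_congr rfl fun j _ => ?_
        have := hq' j
        have : (q' j : ℂ) = (N : ℂ) * (q j : ℂ) := by exact_mod_cast this
        rw [this, mul_assoc]
      rw [e1, hhA, mul_zero, zero_add]
      push_cast
      rw [Finset.sum_mul]
      refine Finset.sum_congr rfl fun j _ => ?_
      rw [hp j]; ring
    rw [e]
    exact Complex.exp_int_mul_two_pi_mul_I _
  have := (mem_charPerp_iff.mp hθ) q' hq'Γ
  have e : ∑ j, (q' j : ℂ) * θ j = N * ∑ j, (q j : ℂ) * θ j := by
    rw [Finset.mul_sum]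
    refine Finset.sum_congr rfl fun j _ => ?_
    have := hq' j
    have : (q' j : ℂ) = (N : ℂ) * (q j : ℂ) := by exact_mod_cast this
    rw [this, mul_assoc]
  rw [e] at this
  exact (mul_eq_zero.mp this).resolve_left (by exact_mod_cast hN)

/-- **Hull theorem** (at most one elliptic factor, complex multiplication allowed). A FORM
vanishing on a complex subspace `𝔥 ≤ Lie M_κ,ℂ` (through `F_P = P(Θ)`) vanishes on the Lie algebra
`(hullData 𝔥).tangent` of the hull of `𝔥`: `𝔍(𝔥) = 𝔍(Lie G')` for the connected algebraic
subgroup `G' ⊇ exp(𝔥)` with datum `hullData 𝔥`. Proof: starting from `𝔥`, enlarge the subspace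
by `s`-moves (`thetaEval_eq_zero_of_forall_natMul_lattice`) and torus moves
(`thetaEval_eq_zero_of_forall_mem_addSubgroup`) inside `Lie(hull)` while the form keeps
vanishing; by dimension this stops, and a stable stage is the whole of `Lie(hull)`
(`hull_tangent_le_of_stable`). [folklore] -/
theorem thetaEval_eq_zero_on_hull (hγ : Fintype.card γ ≤ 1) (𝔥 : Submodule ℂ (β ⊕ (γ ⊕ δ) → ℂ))
    {P : MvPolynomial (Option β × ThetaIdx γ δ) ℂ} {D : ℕ} (hP : P.IsHomogeneous D)
    (hvan : ∀ w ∈ 𝔥, thetaEval L κM P w = 0) :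
    ∀ w ∈ (hullData κM 𝔥).tangent, thetaEval L κM P w = 0 := by
  classical
  set 𝔨 := (hullData κM 𝔥).tangent with h𝔨
  -- induction on the codimension of the stage `𝔥'` in `𝔨`
  suffices key : ∀ d : ℕ, ∀ 𝔥' : Submodule ℂ (β ⊕ (γ ⊕ δ) → ℂ), 𝔥 ≤ 𝔥' → 𝔥' ≤ 𝔨 →
      Module.finrank ℂ 𝔨 ≤ Module.finrank ℂ 𝔥' + d → (∀ w ∈ 𝔥', thetaEval L κM P w = 0) →
      ∀ w ∈ 𝔨, thetaEval L κM P w = 0 by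
    exact key (Module.finrank ℂ 𝔨) 𝔥 le_rfl (le_hull_tangent κM 𝔥) (Nat.le_add_left _ _) hvan
  intro d
  induction d with
  | zero =>
    intro 𝔥' _ h2 h3 h4 w hw
    rw [add_zero] at h3
    have : 𝔥' = 𝔨 := Submodule.eq_of_le_of_finrank_le h2 h3
    exact h4 w (this ▸ hw)
  | succ d ih =>
    intro 𝔥' h1 h2 h3 h4
    by_cases hst : (∀ t ∈ 𝔥', ∀ m n : γ → ℤ, (∀ b, t (iz b) = (m b : ℂ) * L.ω₁ + (n b : ℂ) * L.ω₂) →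
        coords 0 0 (cvec L κM t m n) ∈ 𝔥') ∧
        (∀ θ ∈ charPerp (moveGroup L κM 𝔥'), coords θ (0 : γ → ℂ) (0 : δ → ℂ) ∈ 𝔥')
    · -- stable: `𝔥' = 𝔨`
      intro w hw
      exact h4 w (hull_tangent_le_of_stable hγ h1 hst.1 hst.2 hw)
    · -- a move enlarges `𝔥'` inside `𝔨`
      obtain ⟨x, hx𝔨, hx𝔥', hxvan⟩ : ∃ x, x ∈ 𝔨 ∧ x ∉ 𝔥' ∧
          ∀ w ∈ 𝔥', ∀ a : ℂ, thetaEval L κM P (w + a • x) = 0 := by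
        rw [not_and_or] at hst
        rcases hst with hS | hY
        · simp only [not_forall] at hS
          obtain ⟨t, ht, m, n, hmn, hx⟩ := hS
          refine ⟨_, coords_cvec_mem_hull (h2 ht) m n hmn, hx, fun w hw a => ?_⟩
          have := thetaEval_eq_zero_of_forall_natMul_lattice L κM hP (X := (𝔥' : Set _)) h4 m n hmn
            (w := w) (fun k => 𝔥'.add_mem hw (𝔥'.smul_mem _ ht)) (θ := 0) (fun q _ => by simp) a
          have e : a • coords (0 : β → ℂ) (0 : γ → ℂ) (cvec L κM t m n) =
              coords 0 0 (fun e => a * (t (is e) - ∑ b, (κM e b : ℂ) * ((m b : ℂ) * L.η₁ + (n b : ℂ) * L.η₂))) := by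
            rw [← coords_smul, smul_zero, smul_zero]; rfl
          rwa [e]
        · simp only [not_forall] at hY
          obtain ⟨θ, hθ, hx⟩ := hY
          refine ⟨_, coords_charPerp_mem_hull h2 hθ, hx, fun w hw a => ?_⟩
          have e : a • coords θ (0 : γ → ℂ) (0 : δ → ℂ) = coords (a • θ) 0 0 := by
            rw [← coords_smul, smul_zero, smul_zero]
          rw [e]
          exact thetaEval_eq_zero_of_forall_mem_addSubgroup L κM P (moveGroup L κM 𝔥')
            (fun g hg => thetaEval_eq_zero_of_mem_moveGroup hP h4 hw hg) ((charPerp _).smul_mem a hθ)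
      -- the enlarged stage
      set 𝔥'' := 𝔥' ⊔ ℂ ∙ x with h𝔥''
      have hlt : 𝔥' < 𝔥'' := by
        refine lt_of_le_of_ne le_sup_left fun heq => hx𝔥' ?_
        rw [heq]
        exact Submodule.mem_sup_right (Submodule.mem_span_singleton_self x)
      have hrank : Module.finrank ℂ 𝔥' < Module.finrank ℂ 𝔥'' := Submodule.finrank_lt_finrank_of_lt hlt
      refine ih 𝔥'' (h1.trans le_sup_left) (sup_le h2 ((Submodule.span_singleton_le_iff_mem _ _).mpr hx𝔨))
        (by omega) ?_
      intro w hw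
      rw [h𝔥'', Submodule.mem_sup] at hw
      obtain ⟨w', hw', v, hv, rfl⟩ := hw
      rw [Submodule.mem_span_singleton] at hv
      obtain ⟨a, rfl⟩ := hv
      exact hxvan w' hw' a

/-- **Hull theorem, set form**: `𝔍(𝔥) = 𝔍(Lie(hull 𝔥))` on forms. [folklore] -/
theorem thetaEval_eq_zero_on_hull_iff (hγ : Fintype.card γ ≤ 1) (𝔥 : Submodule ℂ (β ⊕ (γ ⊕ δ) → ℂ))
    {P : MvPolynomial (Option β × ThetaIdx γ δ) ℂ} {D : ℕ} (hP : P.IsHomogeneous D) :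
    (∀ w ∈ (hullData κM 𝔥).tangent, thetaEval L κM P w = 0) ↔ ∀ w ∈ 𝔥, thetaEval L κM P w = 0 :=
  ⟨fun h w hw => h w (le_hull_tangent κM 𝔥 hw), thetaEval_eq_zero_on_hull hγ 𝔥 hP⟩

end HullTheorem

/-! ### Saturation: the preimage of a subtorus -/

section Saturation

omit [Fintype γ] [Fintype δ] [DecidableEq γ]

/-- The integer vectors of a rational subspace `A ≤ ℚ^β`, as a `ℤ`-submodule of `ℤ^β`. [folklore] -/
def intRel (A : Submodule ℚ (β → ℚ)) : Submodule ℤ (β → ℤ) where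
  carrier := {q | (fun j => (q j : ℚ)) ∈ A}
  zero_mem' := by
    show (fun j => (((0 : β → ℤ) j : ℤ) : ℚ)) ∈ A
    have e : (fun j => (((0 : β → ℤ) j : ℤ) : ℚ)) = 0 := by funext j; simp
    rw [e]; exact A.zero_mem
  add_mem' := by
    intro q q' hq hq'
    show (fun j => (((q + q') j : ℤ) : ℚ)) ∈ A
    have e : (fun j => (((q + q') j : ℤ) : ℚ)) = (fun j => (q j : ℚ)) + fun j => (q' j : ℚ) := by
      funext j; simp
    rw [e]; exact A.add_mem hq hq'
  smul_mem' := by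
    intro c q hq
    show (fun j => (((c • q) j : ℤ) : ℚ)) ∈ A
    have e : (fun j => (((c • q) j : ℤ) : ℚ)) = (c : ℚ) • fun j => (q j : ℚ) := by
      funext j; simp
    rw [e]; exact A.smul_mem _ hq

omit [Fintype β] in
/-- Membership in `intRel`. [folklore] -/
theorem mem_intRel_iff {A : Submodule ℚ (β → ℚ)} {q : β → ℤ} : q ∈ intRel A ↔ (fun j => (q j : ℚ)) ∈ A :=
  Iff.rfl

/-- **Saturation (the preimage of a subtorus is `Lie + 2πiℤ^β`).** If `e^{⟨q, y⟩} = 1` for every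
integer vector `q` of a rational subspace `A ≤ ℚ^β`, then `y ∈ A^⊥ + 2πi ℤ^β`: there is
`m ∈ ℤ^β` with `⟨q, y - 2πi m⟩ = 0` for all `q ∈ A`. (The integer vectors of `A` form a saturated
subgroup `N` of `ℤ^β`; `ℤ^β/N` is torsion-free, hence free, so `ℤ^β → ℤ^β/N` splits and the integer
functional `q ↦ ⟨q, y⟩/2πi` on `N` extends to `ℤ^β`.) [folklore] -/
theorem exists_int_shift_of_forall_exp_eq_one (A : Submodule ℚ (β → ℚ)) (y : β → ℂ)
    (h : ∀ q : β → ℤ, (fun j => (q j : ℚ)) ∈ A → cexp (∑ j, (q j : ℂ) * y j) = 1) :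
    ∃ m : β → ℤ, ∀ q ∈ A, ∑ j, (q j : ℂ) * (y j - 2 * Real.pi * I * m j) = 0 := by
  classical
  have h2pi : (2 * Real.pi * I : ℂ) ≠ 0 := by simp [Real.pi_ne_zero, I_ne_zero]
  set N : AddSubgroup (β → ℤ) := (intRel A).toAddSubgroup with hN
  have hmemN : ∀ {q : β → ℤ}, q ∈ N ↔ (fun j => (q j : ℚ)) ∈ A := fun {q} => Iff.rfl
  -- the integer functional `n(q)` with `⟨q, y⟩ = n(q) · 2πi` on `N`
  have hn : ∀ q : N, ∃ n : ℤ, ∑ j, ((q : β → ℤ) j : ℂ) * y j = n * (2 * Real.pi * I) :=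
    fun q => Complex.exp_eq_one_iff.mp (h q q.2)
  choose n hn using hn
  have hn_unique : ∀ (q : N) (k : ℤ), ∑ j, ((q : β → ℤ) j : ℂ) * y j = k * (2 * Real.pi * I) → n q = k := by
    intro q k hk
    have := (hn q).symm.trans hk
    exact_mod_cast (mul_left_injective₀ h2pi this)
  have hn_add : ∀ q q' : N, n (q + q') = n q + n q' := by
    intro q q'
    apply hn_unique
    push_cast
    rw [add_mul, ← hn q, ← hn q', ← Finset.sum_add_distrib]
    refine Finset.sum_congr rfl fun j _ => ?_
    simp only [Pi.add_apply, Int.cast_add]; ring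
  have hn_zero : n 0 = 0 := by
    apply hn_unique
    simp
  let f : N →+ ℤ := { toFun := n, map_zero' := hn_zero, map_add' := hn_add }
  -- the quotient `Q = ℤ^β / N` is a finitely generated torsion-free, hence free, `ℤ`-module
  set π : (β → ℤ) →ₗ[ℤ] (β → ℤ) ⧸ N := (QuotientAddGroup.mk' N).toIntLinearMap with hπ
  have hπ_surj : Function.Surjective π := QuotientAddGroup.mk'_surjective N
  have hπ_ker : ∀ q : β → ℤ, π q = 0 ↔ q ∈ N := fun q => QuotientAddGroup.eq_zero_iff q
  haveI : Module.Finite ℤ (β → ℤ) := Module.Finite.pi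
  haveI : Module.Finite ℤ ((β → ℤ) ⧸ N) := Module.Finite.of_surjective π hπ_surj
  haveI : Module.IsTorsionFree ℤ ((β → ℤ) ⧸ N) := by
    refine Module.IsTorsionFree.of_smul_eq_zero fun c x hcx => ?_
    obtain ⟨v, rfl⟩ := hπ_surj x
    by_cases hc : c = 0
    · exact Or.inl hc
    · right
      rw [hπ_ker, hmemN]
      rw [← map_zsmul π, hπ_ker, hmemN] at hcx
      have := A.smul_mem (c : ℚ)⁻¹ hcx
      convert this using 1
      funext j
      simp only [Pi.smul_apply, smul_eq_mul, Int.cast_mul]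
      field_simp [(show (c : ℚ) ≠ 0 by exact_mod_cast hc)]
  haveI : Module.Free ℤ ((β → ℤ) ⧸ N) := Module.free_of_finite_type_torsion_free'
  -- a splitting of `π`
  obtain ⟨sec, hsec⟩ := Module.projective_lifting_property π LinearMap.id hπ_surj
  have hsec' : ∀ x, π (sec x) = x := fun x => by
    have := LinearMap.congr_fun hsec x
    simpa using this
  -- the projection onto `N` and the extended functional
  have hproj_mem : ∀ q : β → ℤ, q - sec (π q) ∈ N := by
    intro q
    rw [← hπ_ker, map_sub, hsec', sub_self]
  let F : (β → ℤ) → ℤ := fun q => f ⟨q - sec (π q), hproj_mem q⟩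
  have hF_add : ∀ q q' : β → ℤ, F (q + q') = F q + F q' := by
    intro q q'
    show f _ = f _ + f _
    rw [← map_add]
    congr 1
    apply Subtype.ext
    simp only [AddSubgroup.coe_add, map_add]
    abel
  have hF_smul : ∀ (c : ℤ) (q : β → ℤ), F (c • q) = c * F q := by
    intro c q
    show f _ = c * f _
    rw [← smul_eq_mul, ← map_zsmul]
    congr 1
    apply Subtype.ext
    simp only [AddSubgroup.coe_zsmul, map_zsmul, smul_sub]
  have hF_N : ∀ q : β → ℤ, ∀ hq : q ∈ N, F q = n ⟨q, hq⟩ := by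
    intro q hq
    show f _ = n ⟨q, hq⟩
    have hs0 : sec (π q) = 0 := by
      rw [(hπ_ker q).mpr hq, map_zero]
    show n _ = n _
    congr 1
    apply Subtype.ext
    simp [hs0]
  refine ⟨fun j => F (Pi.single j 1), ?_⟩
  have hF : ∀ q : β → ℤ, F q = ∑ j, q j * F (Pi.single j 1) := by
    intro q
    conv_lhs => rw [← Finset.univ_sum_single q]
    have hsum : ∀ (S : Finset β), F (∑ j ∈ S, Pi.single j (q j)) = ∑ j ∈ S, q j * F (Pi.single j 1) := by
      intro S
      induction S using Finset.induction_on with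
      | empty =>
        simp only [Finset.sum_empty]
        have := hF_smul 0 0
        simpa using this
      | insert a S ha ih =>
        rw [Finset.sum_insert ha, Finset.sum_insert ha, hF_add, ih]
        congr 1
        have : (Pi.single a (q a) : β → ℤ) = q a • (Pi.single a (1 : ℤ) : β → ℤ) := by
          funext j'
          by_cases hj : j' = a
          · subst hj; simp
          · simp [hj]
        rw [this, hF_smul]
    exact hsum Finset.univ
  -- integer vectors of `A`
  have hint : ∀ q : β → ℤ, (fun j => (q j : ℚ)) ∈ A →
      ∑ j, (q j : ℂ) * (y j - 2 * Real.pi * I * (F (Pi.single j 1) : ℂ)) = 0 := by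
    intro q hq
    have hqN : q ∈ N := hmemN.mpr hq
    have := hn ⟨q, hqN⟩
    simp only at this
    rw [← hF_N q hqN, hF q] at this
    simp only [mul_sub, Finset.sum_sub_distrib, this]
    push_cast
    rw [Finset.sum_mul, sub_eq_zero]
    refine Finset.sum_congr rfl fun j _ => ?_
    ring
  -- rational vectors of `A`: clear denominators
  intro q hq
  obtain ⟨M, hM, q', hq'⟩ := exists_int_vector_of_rat q
  have hq'A : (fun j => (q' j : ℚ)) ∈ A := by
    have := A.smul_mem (M : ℚ) hq
    convert this using 1
    funext j; simp [hq' j]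
  have := hint q' hq'A
  have e : ∑ j, (q' j : ℂ) * (y j - 2 * Real.pi * I * (F (Pi.single j 1) : ℂ)) =
      M * ∑ j, (q j : ℂ) * (y j - 2 * Real.pi * I * (F (Pi.single j 1) : ℂ)) := by
    rw [Finset.mul_sum]
    refine Finset.sum_congr rfl fun j _ => ?_
    have h1 := hq' j
    have h2 : (q' j : ℂ) = (M : ℂ) * (q j : ℂ) := by exact_mod_cast h1
    rw [h2, mul_assoc]
  rw [e] at this
  exact (mul_eq_zero.mp this).resolve_left (by exact_mod_cast hM)

end Saturation

end Std

end GaGmE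

end Literature.NumberTheory.Transcendental

end
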